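import Literature.AlgebraicGeometry.Villamayor2007.CharPolyGenerators
import Mathlib.RingTheory.AdjoinRoot
import Mathlib.LinearAlgebra.Charpoly.ToMatrix
import Mathlib.RingTheory.ReesAlgebra
import HarnessLib

/-!
# Villamayor 2007, 1.18 / 1.42 (specialized) and Bravo–Villamayor 2010, Par. 2.8 (2.8.1): the characteristic
# polynomial of MULTIPLICATION BY `g(Z)` on `B = S[Z]/⟨f(Z)⟩` and the weighted algebra of its coefficients

O. E. Villamayor U., *Hypersurface singularities in positive characteristic*, Adv. Math. **213** (2007) 687–733
= arXiv:math/0606796 [Villamayor2007]: 1.18–1.19 p0010 L1–L28, 1.39 p0013 L99–L112, Def. 1.42 p0014 L16–L60,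
Example 6.10 p0031 L26–L59; A. Bravo, O. E. Villamayor U., *Singularities in positive characteristic,
stratification and simplification of the singular locus*, Adv. Math. **224** (2010) 1349–1418 = arXiv:0807.4308
[BravoVillamayor2010]: Paragraph 2.8, chunks p0024 L132–p0025 L19. Locators «p00NN Lnn» = chunk · line of the
held arXiv texts (`lit read paper:arxiv-math_0606796`, `lit read paper:arxiv-0807.4308`; re-read before typing).
Campaign `res-hironaka` (D-0089), ladder rung LIT-6. VOCABULARY + PROOF file over Mathlib's `AdjoinRoot` and
`LinearMap.charpoly`: three real definitions, their API and **Lemma 1.19** PROVED, NO named facts; nothing of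
Hironaka's 2017 manuscript is referred to. The bridge to the symmetric-function files of this folder
(`UniversalElimination.univMonic = F_b`, `CharPolyGenerators.charPolyOf` = the product form of `ψ_Θ`) is
`mulCharpoly_univMonic` (Lemma 1.19) at the end.

## What is typed

* **1.18 p0010 L1–L7** «The ring `k[s_{b,1},…,s_{b,b}][Y_1]` is a free module of rank `b` over
  `k[s_{b,1},…,s_{b,b}]`. Multiplication by an element `Θ ∈ k[s_{b,1},…,s_{b,b}][Y_1]` defines an endomorphism,
  say `φ_Θ`, with characteristic polynomial, say `ψ_Θ(V) = V^b + h_1V^{b−1} + ⋯ + h_b`», and its concrete form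
  **BV2010 Par. 2.8 p0025 L1–L19** «multiplying by an element `f_{n_i}W^{n_i}` induces an endomorphism
  `L_{f_{n_i}}` … Since `(𝒪_{V^{(d−1)},x_1}[Z]/⟨F(Z)⟩)[W]` is a free `𝒪_{V^{(d−1)},x_1}[W]`-module of rank `n`,
  each endomorphism `L_{f_{n_i}}` has a characteristic polynomial of degree `n`,
  `T^n + g_{1,n_i}T^{n−1} + … + g_{n,n_i}` (2.8.1) where `g_{j,n_i} ∈ 𝒪_{V^{(d−1)},x_1}[W]` and the elimination
  algebra `ℛ_{𝒢,β_{d,d−1}}` is generated by these coefficients up to integral closure». TYPED for a monic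
  `f ∈ S[Z]` over any commutative ring `S` (the specialized setting of Def. 1.42; the universal 1.18 is the case
  `S = k[s_{b,1},…,s_{b,b}]`, `f = F_b`): `B = S[Z]/⟨f⟩` is Mathlib's `AdjoinRoot f`, free of rank `deg f`
  (`Polynomial.Monic.free_adjoinRoot`), and `mulCharpoly f hf g ∈ S[T]` is `LinearMap.charpoly` of multiplication
  by the class of `g ∈ S[Z]`. PROVED: `ψ_g` is monic of degree `deg f` (`mulCharpoly_monic`,
  `natDegree_mulCharpoly`); Cayley–Hamilton «1) `ψ_Θ(Θ) = 0`» (Lemma 1.19, p0010 L19: `aeval_mk_mulCharpoly`,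
  `dvd_comp_mulCharpoly : f ∣ ψ_g(g(Z))`); `ψ_0 = T^{deg f}`, `ψ_c = (T − c)^{deg f}`, `ψ_{g+c}(T + c) = ψ_g(T)`
  (`mulCharpoly_zero`, `mulCharpoly_C`, `comp_mulCharpoly_add_C`); the case `Θ = Y_1` of **Lemma 1.19** p0010
  L9–L14 («`ψ_Θ(V) = ∏_{1≤j≤b} (V − (a_0 + a_1Y_j + ⋯))`», i.e. `ψ_{Y_1} = F_b`): `mulCharpoly_X : ψ_Z = f`; the
  matrix of multiplication in the power basis (`toMatrix_lmul_mk_apply`); and compatibility with every CHANGE OF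
  BASE RINGS `φ : S → S'` (Def. 1.42 p0014 L16–L28 «each `f_i(Z)` is obtained from `F_{c_i}(Z)` by the change of
  base rings `π : k[s^{(i)}] → S`»): `mulCharpoly_map : φ(ψ_g) = ψ_{φ(g)}`.
* **The weighted algebra of coefficients** (1.39 p0013 L99–L112 «graded inclusion … generated by
  `{H_1W^{d_1},…,H_sW^{d_s}}`», Def. 1.42 p0014 L44–L52, BV2010 (2.8.1)): for a homogeneous element `g·W^n`, the
  coefficient of `T^{deg f − j}` in `ψ_g` has weight `j·n` (Cor. 1.20; in (2.8.1) this is the power of `W` in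
  `g_{j,n_i} ∈ 𝒪[W]`, since `det(T − W^{n}L_g) = W^{n·deg f}·ψ_g(T/W^{n})`). `mulCharpolyRees f hf g n ⊂ S[W]` is
  the `S`-subalgebra generated by these weighted coefficients, `mulCharpolyReesOfFamily` the one of a family
  `{g_i W^{n_i}}`; PROVED: generators belong (`monomial_coeff_mem_mulCharpolyRees`), monotonicity in the family,
  and base change maps generators to generators (`map_mem_mulCharpolyRees`, from `mulCharpoly_map`).
* **Example 6.10 p0031 L31–L48** (a field of characteristic two, `𝒢` the Diff-algebra generated by `(Z²+Y⁵)W²`,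
  «generated by `{Y⁴W, (Z²+Y⁵)W²}`» — the «cusp» specimen): «`ℛ_𝒢` is (up to integral closure) generated by the
  coefficients of the characteristic polynomial of multiplication by `Y⁴` in the free `S`-module
  `B = S[Z]/⟨f_{c_1}(Z)⟩` … In this case `ℋ_𝒢` is generated by `Y⁸W²`». PROVED over any `S` of characteristic `2`
  and any `y ∈ S`: `mulCharpoly_cusp_charTwo : ψ_{y⁴} = T² + y⁸` on `S[Z]/⟨Z² + y⁵⟩`, and
  `mulCharpolyRees_cusp_charTwo`: the weighted coefficient algebra of the weight-one generator `y⁴W` is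
  `S[y⁸W²]`, as printed.
* **Lemma 1.19 p0010 L9–L28** «if `Θ = a_0 + a_1Y_1 + ⋯ + a_{b−1}Y_1^{b−1}`,
  `ψ_Θ(V) = ∏_{1≤j≤b} (V − (a_0 + a_1Y_j + ⋯ + a_{b−1}Y_j^{b−1}))`». PROVED, by a different route than the printed
  one (which uses that `𝕊_b` is the Galois group of `k[s] ⊂ k[Y]`): `mulCharpoly_mul` — for monic `f₁, f₂` and any
  `g`, `ψ^{f₁f₂}_g = ψ^{f₁}_g·ψ^{f₂}_g` over ANY commutative ring (the division algorithm gives an `S`-linear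
  bijection `S[Z]/⟨f₁⟩ × S[Z]/⟨f₂⟩ ≅ S[Z]/⟨f₁f₂⟩` in which multiplication by `g` is block-triangular;
  `Matrix.charpoly_fromBlocks_zero₁₂`); with the rank-one case `mulCharpoly_X_sub_C` (`ψ_g = T − g(α)` on
  `S[Z]/⟨Z − α⟩`) this gives the split form `mulCharpoly_prod_X_sub_C(')`: `f = ∏ (Z − α_i) ⇒ ψ_g = ∏ (T − g(α_i))`,
  and for `F_b = ∏ (Z − Y_j)` over `k[Y_1,…,Y_b]` exactly the printed statement
  `mulCharpoly_univMonic : ψ_q = CharPolyGenerators.charPolyOf ι k q`; hence Def. 1.21 `H_{F_b}`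
  (`CharPolyGenerators.hSubalgebra`, typed by the product form) is generated by coefficients of characteristic
  polynomials of multiplication maps as printed (`hSubalgebra_eq_adjoin_coeff_mulCharpoly`).
* **The weights of (2.8.1) as a theorem** (`section Scale`): `mulCharpoly_C_mul : ψ_{c·g} = scaleRoots ψ_g c`
  for every `c ∈ S` (so, after the base change `S → S[W]`, the coefficient of `T^{deg f − j}` of the
  characteristic polynomial of multiplication by `g·W^n` is `ψ_{g,deg f−j}·W^{jn}`), proved by the generic
  element `u ∈ S[u]` (`mulCharpoly_C_mul_comp : ψ_{cg}(cT) = c^{deg f}ψ_g(T)`, `charpoly_smul_comp_C_mul_X`);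
  the homothety `Z ↦ uZ` (`mulCharpoly_scaleRoots`) and the translation `Z ↦ Z + s` (`mulCharpoly_taylor`,
  §1.5 «`Z_1 = Z − s`») do not change `ψ`, both through `charpoly_eq_of_semiconj` (intertwined endomorphisms
  with an intertwiner of non-zero-divisor determinant have equal characteristic polynomials).
* **Orders of the coefficients** (`section Order`, `section Weighted`; the degree bookkeeping of Rem. 1.14 /
  1.15 / Thm. 1.16 (ii) p0008 L138–p0009 L53 carried over to the characteristic polynomials of 1.18 / (2.8.1)):
  `coeff_mulCharpoly_mem_pow` — if `g ∈ I·S[Z]` then the coefficient of `T^k` of `ψ_g` lies in `I^{deg f − k}`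
  (`Matrix.coeff_charpoly_mem_ideal_pow`); and the WEIGHTED form `coeff_mulCharpoly_mem_pow_of_weights(_taylor)`
  — if `f = Σ a_i (Z − s)^{b−i}` with `a_i ∈ I^i` (a `b`-fold point at `Z = s` along `I`, the ideal-form
  hypothesis of `OrderAlongSection`) and `g·W^n` has weighted order `≥ n` at `Z = s` (`g = Σ g_l (Z − s)^l`,
  `g_l ∈ I^{n−l}`), then the coefficient of `T^k` of `ψ_g` lies in `I^{n(b−k)}`, i.e. the generator
  `ψ_{g,b−j}W^{jn}` of `mulCharpolyRees f g n` has order `≥ jn` along `I` — proved by moving the weights into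
  Mathlib's Rees algebra `⊕ I^m u^m ⊂ S[u]` (`u^b f(Z/u)`, `u^n g(Z/u)` have coefficients there, hence so does
  their `ψ` by `mulCharpoly_map`, and it equals `Σ ψ_{g,k} u^{n(b−k)} T^k` by `mulCharpoly_scaleRoots` +
  `mulCharpoly_C_mul`).
* **Thm. 4.11 (iii) p0022 L100–L102 «`𝒢̄` is integral over `R_𝒢`», for the coefficient algebra**
  (`section Integral`): `isIntegralElem_monomial_mk` — each `ḡ·W^n ∈ B[W]` (`B = S[Z]/⟨f⟩`) is a root of the
  MONIC polynomial `T^b + Σ_{k<b} (ψ_{g,k}W^{(b−k)n}) T^k` with coefficients in `mulCharpolyRees f g n` (the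
  homogenised Cayley–Hamilton identity), i.e. is integral over the algebra of its own characteristic
  coefficients — the integral-dependence half of BV2010's «generated by these coefficients up to integral
  closure».
* **Closed form for `deg f = 2`** (`section Quadratic`, the `Z`-quadratic specimens such as `Z² + Y⁵`):
  `mulCharpoly_quadratic : ψ_{c₀ + c₁Z} = T² − (2c₀ − a₁c₁)T + (c₀² − a₁c₀c₁ + a₂c₁²)` for
  `f = Z² + a₁Z + a₂` over any commutative ring (`Matrix.charpoly_fin_two` on the matrix `[[c₀, −a₂c₁],
  [c₁, c₀ − a₁c₁]]`), with `monic_quadratic`.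
* **Purely inseparable specimens in characteristic `p`** (`section CharP`, Example 6.10 generalised from
  `p = 2`): for `f` monic of degree `p` (e.g. `Z^p + a`) and a constant `c`, `mulCharpoly_C_of_charP :
  ψ_c = T^p − c^p` and `mulCharpolyRees_C_of_charP`: the weighted coefficient algebra of the weight-`n` generator
  `c·W^n` is `S[c^p W^{pn}]`.
* NOT typed (named so that no one assumes them): Cor. 1.20 in its universal form (weighted homogeneity of the
  coefficients of `ψ_Θ` in `k[Y]` — cf. `CharPolyGenerators.isHomogeneous_coeff_charPolyOf_univMonicDelta` for
  `Θ = Δ^e F_b`); Prop. 1.23 / 1.38 and BV2010's «up to integral closure» (`R̄` is the integral closure of `ℋ`);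
  the identification of the specialized `ℋ_f` of `CharPolyGenerators.hElimAlgebra` (built from the homogeneous
  pieces of `H_{F_b}`) with `mulCharpolyReesOfFamily f {(Δ^e f, b − e)}`.

## References

* O. E. Villamayor U., Adv. Math. 213 (2007) 687–733 = arXiv:math/0606796: §1.5, Rem. 1.14–1.15, Thm. 1.16,
  1.18, Lemma 1.19, Def. 1.21, 1.39, Def. 1.42, Thm. 4.11 (iii), Ex. 6.10. [Villamayor2007]
* A. Bravo, O. E. Villamayor U., Adv. Math. 224 (2010) 1349–1418 = arXiv:0807.4308: Par. 2.7–2.8 (2.8.1).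
  [BravoVillamayor2010]
-/

noncomputable section

open scoped Polynomial

namespace Literature.AlgebraicGeometry.Villamayor2007

universe u v w

section MulCharpoly

variable {S : Type u} [CommRing S]

/-- **The characteristic polynomial `ψ_g` of multiplication by `g(Z)` on `B = S[Z]/⟨f(Z)⟩`** [Villamayor 2007,
1.18 p0010 L1–L7 «Multiplication by an element `Θ ∈ k[s_{b,1},…,s_{b,b}][Y_1]` defines an endomorphism, say `φ_Θ`,
with characteristic polynomial, say `ψ_Θ(V) = V^b + h_1V^{b−1} + ⋯ + h_b`»; Bravo–Villamayor 2010, Par. 2.8 (2.8.1)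
«each endomorphism `L_{f_{n_i}}` has a characteristic polynomial of degree `n`, `T^n + g_{1,n_i}T^{n−1} + … +
g_{n,n_i}`»]: for `f ∈ S[Z]` monic, `B = AdjoinRoot f` is free of rank `deg f` over `S`, and `mulCharpoly f hf g`
is `LinearMap.charpoly` of multiplication by the class of `g` on `B`. [cite: Villamayor2007, 1.18 p0010 L1–L7] -/
def mulCharpoly (f : S[X]) (hf : f.Monic) (g : S[X]) : S[X] :=
  haveI := hf.free_adjoinRoot
  haveI := hf.finite_adjoinRoot
  (Algebra.lmul S (AdjoinRoot f) (AdjoinRoot.mk f g)).charpoly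

/-- `ψ_g` is monic («`ψ_Θ(V) = V^b + h_1V^{b−1} + ⋯ + h_b`», 1.18). [cite: Villamayor2007, 1.18 p0010 L1–L7] -/
theorem mulCharpoly_monic (f : S[X]) (hf : f.Monic) (g : S[X]) : (mulCharpoly f hf g).Monic := by
  haveI := hf.free_adjoinRoot
  haveI := hf.finite_adjoinRoot
  exact LinearMap.charpoly_monic _

/-- `ψ_g` has degree `deg f` = the rank of `B = S[Z]/⟨f⟩` («a free … module of rank `n` … a characteristic polynomial
of degree `n`», BV2010 Par. 2.8). [cite: BravoVillamayor2010, Par. 2.8 (2.8.1)] -/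
theorem natDegree_mulCharpoly [Nontrivial S] (f : S[X]) (hf : f.Monic) (g : S[X]) :
    (mulCharpoly f hf g).natDegree = f.natDegree := by
  haveI := hf.free_adjoinRoot
  haveI := hf.finite_adjoinRoot
  rw [mulCharpoly, LinearMap.charpoly_natDegree, (AdjoinRoot.powerBasis' hf).finrank,
    AdjoinRoot.powerBasis'_dim]

/-- **Cayley–Hamilton for `ψ_g`** (Lemma 1.19, observation «1) `ψ_Θ(Θ) = 0`», p0010 L19): `ψ_g(g) = 0` in
`B = S[Z]/⟨f⟩`. [cite: Villamayor2007, Lemma 1.19 p0010 L9–L19] -/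
theorem aeval_mk_mulCharpoly (f : S[X]) (hf : f.Monic) (g : S[X]) :
    Polynomial.aeval (AdjoinRoot.mk f g) (mulCharpoly f hf g) = 0 := by
  haveI := hf.free_adjoinRoot
  haveI := hf.finite_adjoinRoot
  apply Algebra.lmul_injective (R := S) (A := AdjoinRoot f)
  rw [map_zero, ← Polynomial.aeval_algHom_apply]
  exact LinearMap.aeval_self_charpoly _

/-- Cayley–Hamilton, polynomial form: `f(Z)` divides `ψ_g(g(Z))` in `S[Z]`.
[cite: Villamayor2007, Lemma 1.19 p0010 L9–L19] -/
theorem dvd_comp_mulCharpoly (f : S[X]) (hf : f.Monic) (g : S[X]) : f ∣ (mulCharpoly f hf g).comp g := by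
  rw [← AdjoinRoot.mk_eq_zero, ← AdjoinRoot.aeval_eq, Polynomial.aeval_comp, AdjoinRoot.aeval_eq]
  exact aeval_mk_mulCharpoly f hf g

/-- `ψ_0 = T^{deg f}` (the zero endomorphism of a free module of rank `deg f`). [cite: Villamayor2007, 1.18 p0010 L1–L7] -/
theorem mulCharpoly_zero [Nontrivial S] (f : S[X]) (hf : f.Monic) :
    mulCharpoly f hf 0 = Polynomial.X ^ f.natDegree := by
  haveI := hf.free_adjoinRoot
  haveI := hf.finite_adjoinRoot
  rw [mulCharpoly, map_zero, map_zero, LinearMap.charpoly_zero, (AdjoinRoot.powerBasis' hf).finrank,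
    AdjoinRoot.powerBasis'_dim]

/-- Translation by a constant: `ψ_{g + c}(T + c) = ψ_g(T)` (multiplication by `g + c` is `L_g + c·1`;
`LinearMap.charpoly_sub_smul`). Elementary API of 1.18, not printed. [cite: Villamayor2007, 1.18 p0010 L1–L7] -/
theorem comp_mulCharpoly_add_C (f : S[X]) (hf : f.Monic) (g : S[X]) (c : S) :
    (mulCharpoly f hf (g + Polynomial.C c)).comp (Polynomial.X + Polynomial.C c) = mulCharpoly f hf g := by
  haveI := hf.free_adjoinRoot
  haveI := hf.finite_adjoinRoot
  have hlmul : Algebra.lmul S (AdjoinRoot f) (AdjoinRoot.mk f (g + Polynomial.C c)) - c • 1 =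
      Algebra.lmul S (AdjoinRoot f) (AdjoinRoot.mk f g) := by
    rw [map_add, map_add, AdjoinRoot.mk_C, ← AdjoinRoot.algebraMap_eq, AlgHom.commutes,
      Algebra.algebraMap_eq_smul_one, add_sub_cancel_right]
  have h := LinearMap.charpoly_sub_smul (Algebra.lmul S (AdjoinRoot f) (AdjoinRoot.mk f (g + Polynomial.C c))) c
  rw [hlmul] at h
  exact h.symm

/-- Multiplication by a CONSTANT `c ∈ S`: `ψ_c = (T − c)^{deg f}` (the scalar endomorphism `c·1` of a free module
of rank `deg f`). [cite: BravoVillamayor2010, Par. 2.8 (2.8.1)] -/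
theorem mulCharpoly_C [Nontrivial S] (f : S[X]) (hf : f.Monic) (c : S) :
    mulCharpoly f hf (Polynomial.C c) = (Polynomial.X - Polynomial.C c) ^ f.natDegree := by
  have h := comp_mulCharpoly_add_C f hf 0 c
  rw [zero_add, mulCharpoly_zero] at h
  have h2 := congrArg (fun q : S[X] => q.comp (Polynomial.X - Polynomial.C c)) h
  simp only [Polynomial.comp_assoc, Polynomial.add_comp, Polynomial.X_comp, Polynomial.C_comp,
    sub_add_cancel, Polynomial.comp_X, Polynomial.X_pow_comp] at h2
  exact h2

/-- **Lemma 1.19 for `Θ = Y₁`: `ψ_Z = f`** [Villamayor 2007, Lemma 1.19 p0010 L9–L14 «if `Θ = a_0 + a_1Y_1 + ⋯`,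
`ψ_Θ(V) = ∏_{1 ≤ j ≤ b} (V − (a_0 + a_1Y_j + ⋯))`», whose case `Θ = Y₁` reads `ψ_{Y₁}(V) = ∏ (V − Y_j) = F_b(V)`]:
over any `S`, the characteristic polynomial of multiplication by `Z` on `S[Z]/⟨f⟩` is `f` itself (both are monic
of degree `deg f` and `f ∣ ψ_Z` by Cayley–Hamilton). The general product formula is `mulCharpoly_prod_X_sub_C` below.
(Companion-matrix form of the same fact, via `minpoly`: `charpoly_leftMulMatrix_root` in
`Literature.Dynamics.TopologicalDynamics.ToralEndomorphismOfMonicPolynomial` — not imported here, to keep this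
file's import closure inside commutative algebra.) [cite: Villamayor2007, Lemma 1.19 p0010 L9–L14] -/
theorem mulCharpoly_X (f : S[X]) (hf : f.Monic) : mulCharpoly f hf Polynomial.X = f := by
  nontriviality S
  exact Polynomial.eq_of_monic_of_dvd_of_natDegree_le hf (mulCharpoly_monic f hf _)
    (by simpa only [Polynomial.comp_X] using dvd_comp_mulCharpoly f hf Polynomial.X)
    (natDegree_mulCharpoly f hf _).le

/-- The matrix of multiplication by `g` in the power basis `1, Z, …, Z^{deg f − 1}` of `S[Z]/⟨f⟩`
(`AdjoinRoot.powerBasis'`): its `(i, j)` entry is the coefficient of `Z^i` in the remainder of `g·Z^j` modulo `f`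
(1.18: «a free module of rank `b`»). [cite: Villamayor2007, 1.18 p0010 L1–L7] -/
theorem toMatrix_lmul_mk_apply (f : S[X]) (hf : f.Monic) (g : S[X]) (i j : Fin (AdjoinRoot.powerBasis' hf).dim) :
    LinearMap.toMatrix (AdjoinRoot.powerBasis' hf).basis (AdjoinRoot.powerBasis' hf).basis
      (Algebra.lmul S (AdjoinRoot f) (AdjoinRoot.mk f g)) i j = ((g * Polynomial.X ^ (j : ℕ)) %ₘ f).coeff i := by
  rw [LinearMap.toMatrix_apply, PowerBasis.basis_eq_pow, AdjoinRoot.powerBasis'_gen, Algebra.coe_lmul_eq_mul,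
    LinearMap.mul_apply', ← AdjoinRoot.mk_X, ← map_pow, ← map_mul]
  change (AdjoinRoot.powerBasisAux' hf).repr _ i = _
  rw [AdjoinRoot.powerBasisAux'_repr_apply_to_fun, AdjoinRoot.modByMonicHom_mk]

/-- **Specialization / change of base rings** [Villamayor 2007, Def. 1.42 p0014 L16–L28 «each `f_i(Z)` is obtained
from `F_{c_i}(Z)` by the change of base rings `π : k[s^{(i)}_1,…,s^{(i)}_{c_i}] → S`»; Bravo–Villamayor 2010 Par. 2.7
p0024 L97–L102 «`𝒢` is locally … the pull-back of the universal algebra»]: the characteristic polynomial of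
multiplication commutes with every change of base rings `φ : S → S'` — `φ(ψ_g) = ψ_{φ(g)}` computed on
`S'[Z]/⟨φ(f)⟩` (the matrices in the power bases correspond under `φ`, `toMatrix_lmul_mk_apply` and
`Polynomial.map_modByMonic`). [cite: Villamayor2007, Def. 1.42 p0014 L16–L28] -/
theorem mulCharpoly_map {S' : Type v} [CommRing S'] (φ : S →+* S') (f : S[X]) (hf : f.Monic) (g : S[X]) :
    (mulCharpoly f hf g).map φ = mulCharpoly (f.map φ) (hf.map φ) (g.map φ) := by
  nontriviality S'
  haveI := hf.free_adjoinRoot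
  haveI := hf.finite_adjoinRoot
  haveI := (hf.map φ).free_adjoinRoot
  haveI := (hf.map φ).finite_adjoinRoot
  have hdim : (AdjoinRoot.powerBasis' (hf.map φ)).dim = (AdjoinRoot.powerBasis' hf).dim := by
    rw [AdjoinRoot.powerBasis'_dim, AdjoinRoot.powerBasis'_dim, hf.natDegree_map φ]
  have key : (LinearMap.toMatrix (AdjoinRoot.powerBasis' hf).basis (AdjoinRoot.powerBasis' hf).basis
      (Algebra.lmul S (AdjoinRoot f) (AdjoinRoot.mk f g))).map φ =
      Matrix.reindex (finCongr hdim) (finCongr hdim) (LinearMap.toMatrix (AdjoinRoot.powerBasis' (hf.map φ)).basis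
        (AdjoinRoot.powerBasis' (hf.map φ)).basis
        (Algebra.lmul S' (AdjoinRoot (f.map φ)) (AdjoinRoot.mk (f.map φ) (g.map φ)))) := by
    ext i j
    rw [Matrix.map_apply, Matrix.reindex_apply, Matrix.submatrix_apply, toMatrix_lmul_mk_apply,
      toMatrix_lmul_mk_apply, ← Polynomial.coeff_map, Polynomial.map_modByMonic φ hf, Polynomial.map_mul,
      Polynomial.map_pow, Polynomial.map_X, finCongr_symm, finCongr_apply_coe, finCongr_apply_coe]
  rw [mulCharpoly, mulCharpoly,
    ← LinearMap.charpoly_toMatrix (Algebra.lmul S (AdjoinRoot f) (AdjoinRoot.mk f g))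
      (AdjoinRoot.powerBasis' hf).basis,
    ← LinearMap.charpoly_toMatrix (Algebra.lmul S' (AdjoinRoot (f.map φ)) (AdjoinRoot.mk (f.map φ) (g.map φ)))
      (AdjoinRoot.powerBasis' (hf.map φ)).basis,
    ← Matrix.charpoly_map, key, Matrix.charpoly_reindex]

/-- **The weighted algebra of coefficients** [Bravo–Villamayor 2010, Par. 2.8 (2.8.1) «`g_{j,n_i} ∈
𝒪_{V^{(d−1)},x₁}[W]` and the elimination algebra `ℛ_{𝒢,β}` is generated by these coefficients up to integral
closure»]: for a homogeneous element `g·W^n` of a Rees algebra, the coefficient `g_j` of `T^{deg f − j}` in `ψ_g` has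
weight `j·n`; `mulCharpolyRees f hf g n ⊂ S[W]` is the `S`-subalgebra generated by the `g_j·W^{jn}`, `1 ≤ j ≤ deg f`.
(«up to integral closure» is not typed.) [cite: BravoVillamayor2010, Par. 2.8 (2.8.1)] -/
def mulCharpolyRees (f : S[X]) (hf : f.Monic) (g : S[X]) (n : ℕ) : Subalgebra S S[X] :=
  Algebra.adjoin S {q | ∃ j : ℕ, 1 ≤ j ∧ j ≤ f.natDegree ∧
    q = Polynomial.monomial (j * n) ((mulCharpoly f hf g).coeff (f.natDegree - j))}

/-- The generators lie in the algebra. [cite: BravoVillamayor2010, Par. 2.8 (2.8.1)] -/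
theorem monomial_coeff_mem_mulCharpolyRees (f : S[X]) (hf : f.Monic) (g : S[X]) (n : ℕ) {j : ℕ} (hj1 : 1 ≤ j)
    (hj : j ≤ f.natDegree) :
    Polynomial.monomial (j * n) ((mulCharpoly f hf g).coeff (f.natDegree - j)) ∈ mulCharpolyRees f hf g n :=
  Algebra.subset_adjoin ⟨j, hj1, hj, rfl⟩

/-- Specialization of the weighted coefficient algebra (Def. 1.42 p0014 L44–L52: `ℋ_f ⊂ S[W]` is «the subalgebra of
`S[W]` generated by the image» of the universal one under `T[W] → S[W]`): a change of base rings `φ : S → S'`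
maps `mulCharpolyRees f g n` into `mulCharpolyRees φ(f) φ(g) n` (generators to generators, by `mulCharpoly_map`).
[cite: Villamayor2007, Def. 1.42 p0014 L16–L52] -/
theorem map_mem_mulCharpolyRees {S' : Type v} [CommRing S'] [Nontrivial S'] (φ : S →+* S') (f : S[X])
    (hf : f.Monic) (g : S[X]) (n : ℕ) {q : S[X]} (hq : q ∈ mulCharpolyRees f hf g n) :
    q.map φ ∈ mulCharpolyRees (f.map φ) (hf.map φ) (g.map φ) n := by
  induction hq using Algebra.adjoin_induction with
  | mem x hx =>
    obtain ⟨j, hj1, hj2, rfl⟩ := hx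
    rw [Polynomial.map_monomial, ← Polynomial.coeff_map, mulCharpoly_map]
    refine Algebra.subset_adjoin ⟨j, hj1, ?_, ?_⟩
    · rwa [hf.natDegree_map φ]
    · rw [hf.natDegree_map φ]
  | algebraMap r =>
    simpa only [Polynomial.algebraMap_eq, Polynomial.map_C] using
      (mulCharpolyRees (f.map φ) (hf.map φ) (g.map φ) n).algebraMap_mem (φ r)
  | add x y _ _ hx hy => rw [Polynomial.map_add]; exact add_mem hx hy
  | mul x y _ _ hx hy => rw [Polynomial.map_mul]; exact mul_mem hx hy

/-- For a family `ℱ = {g_i·W^{n_i}}` of homogeneous generators: the `S`-subalgebra of `S[W]` generated by all the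
weighted coefficients (BV2010 Par. 2.8 «generated by `{f_{n_1}W^{n_1},…,f_{n_s}W^{n_s}}` … each endomorphism
`L_{f_{n_i}}`»). [cite: BravoVillamayor2010, Par. 2.8 (2.8.1)] -/
def mulCharpolyReesOfFamily (f : S[X]) (hf : f.Monic) (ℱ : Set (S[X] × ℕ)) : Subalgebra S S[X] :=
  ⨆ gn ∈ ℱ, mulCharpolyRees f hf gn.1 gn.2

/-- Each member's coefficient algebra is contained in the family's. [cite: BravoVillamayor2010, Par. 2.8 (2.8.1)] -/
theorem mulCharpolyRees_le_ofFamily (f : S[X]) (hf : f.Monic) {ℱ : Set (S[X] × ℕ)} {g : S[X]} {n : ℕ}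
    (h : (g, n) ∈ ℱ) : mulCharpolyRees f hf g n ≤ mulCharpolyReesOfFamily f hf ℱ :=
  le_iSup₂_of_le (f := fun gn (_ : gn ∈ ℱ) => mulCharpolyRees f hf gn.1 gn.2) (g, n) h le_rfl

/-- **Example 6.10 (characteristic two, the cusp `Z² + Y⁵`)** [Villamayor 2007, Ex. 6.10 p0031 L26–L45 «Fix a field
`k` of characteristic two … the Diff-algebra generated by `(Z²+Y⁵)W²` … is generated by `{Y⁴W, (Z²+Y⁵)W²}` … `ℛ_𝒢`
is (up to integral closure) generated by the coefficients of the characteristic polynomial of multiplication by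
`Y⁴` in the free `S`-module `B = S[Z]/⟨f_{c₁}(Z)⟩` … `ℋ_𝒢` is generated by `Y⁸W²`»]: over any `S` of characteristic
`2` and for any `y ∈ S`, the characteristic polynomial of multiplication by `y⁴` on `S[Z]/⟨Z² + y⁵⟩` is `T² + y⁸` —
so its weighted coefficients for the weight-one generator `Y⁴W` are `0·W` and `y⁸·W²`.
[cite: Villamayor2007, Example 6.10 p0031 L26–L45] -/
theorem mulCharpoly_cusp_charTwo [Nontrivial S] [CharP S 2] (y : S) :
    mulCharpoly (Polynomial.X ^ 2 + Polynomial.C (y ^ 5)) (Polynomial.monic_X_pow_add_C _ two_ne_zero)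
        (Polynomial.C (y ^ 4)) =
      Polynomial.X ^ 2 + Polynomial.C (y ^ 8) := by
  have h2 : (2 : S[X]) = 0 := by
    have h : ((2 : ℕ) : S[X]) = 0 := by
      rw [← map_natCast Polynomial.C, CharP.cast_eq_zero S 2, map_zero]
    exact_mod_cast h
  rw [mulCharpoly_C, Polynomial.natDegree_X_pow_add_C, sub_sq, ← map_pow, ← pow_mul, mul_assoc, h2, zero_mul,
    sub_zero]

/-- **Example 6.10, continued: «`ℋ_𝒢` is generated by `Y⁸W²`»** (p0031 L45–L46): for the weight-one generator
`Y⁴W` of `𝒢 = R[Y⁴W, (Z²+Y⁵)W²]` (p0031 L33–L34) the weighted coefficient algebra of `ψ_{y⁴} = T² + y⁸` is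
`S[y⁸W²] ⊂ S[W]` (the weight-one coefficient vanishes in characteristic two).
[cite: Villamayor2007, Example 6.10 p0031 L31–L48] -/
theorem mulCharpolyRees_cusp_charTwo [Nontrivial S] [CharP S 2] (y : S) :
    mulCharpolyRees (Polynomial.X ^ 2 + Polynomial.C (y ^ 5)) (Polynomial.monic_X_pow_add_C _ two_ne_zero)
        (Polynomial.C (y ^ 4)) 1 =
      Algebra.adjoin S {Polynomial.monomial 2 (y ^ 8)} := by
  have hψ := mulCharpoly_cusp_charTwo y
  have hdeg : (Polynomial.X ^ 2 + Polynomial.C (y ^ 5) : S[X]).natDegree = 2 :=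
    Polynomial.natDegree_X_pow_add_C
  have h0 : (Polynomial.X ^ 2 + Polynomial.C (y ^ 8) : S[X]).coeff 0 = y ^ 8 := by
    rw [Polynomial.coeff_add, Polynomial.coeff_X_pow, Polynomial.coeff_C_zero, if_neg (by norm_num), zero_add]
  have h1 : (Polynomial.X ^ 2 + Polynomial.C (y ^ 8) : S[X]).coeff 1 = 0 := by
    rw [Polynomial.coeff_add, Polynomial.coeff_X_pow, Polynomial.coeff_C_of_ne_zero one_ne_zero,
      if_neg (by norm_num), zero_add]
  apply le_antisymm
  · refine Algebra.adjoin_le ?_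
    rintro q ⟨j, hj1, hj2, rfl⟩
    rw [hdeg] at hj2
    rw [hdeg, hψ, mul_one, SetLike.mem_coe]
    interval_cases j
    · rw [show (2 : ℕ) - 1 = 1 from rfl, h1, map_zero]
      exact zero_mem _
    · rw [Nat.sub_self, h0]
      exact Algebra.subset_adjoin (Set.mem_singleton _)
  · refine Algebra.adjoin_le (Set.singleton_subset_iff.mpr ?_)
    rw [SetLike.mem_coe]
    convert monomial_coeff_mem_mulCharpolyRees (Polynomial.X ^ 2 + Polynomial.C (y ^ 5))
      (Polynomial.monic_X_pow_add_C _ two_ne_zero) (Polynomial.C (y ^ 4)) 1 (j := 2) (by norm_num) hdeg.symm.le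
      using 2
    rw [hdeg, hψ, Nat.sub_self, h0]

end MulCharpoly

/-! ## Lemma 1.19: the product formula `ψ_Θ(V) = ∏_j (V − Θ(Y_j))` -/

section Lemma119

variable {S : Type u} [CommRing S]

/-- `ψ_g` depends only on the class of `g` in `S[Z]/⟨f⟩` (1.18: `Θ ∈ k[s][Y_1] = k[s][Z]/⟨F_b⟩`).
[cite: Villamayor2007, 1.18 p0010 L1–L7] -/
theorem mulCharpoly_congr {f : S[X]} (hf : f.Monic) {g g' : S[X]} (h : AdjoinRoot.mk f g = AdjoinRoot.mk f g') :
    mulCharpoly f hf g = mulCharpoly f hf g' := by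
  unfold mulCharpoly
  rw [h]

/-- Rewriting `f` under `mulCharpoly` (the monicity witness is carried along). [cite: Villamayor2007, 1.18 p0010 L1–L7] -/
theorem mulCharpoly_eq_of_eq {f f' : S[X]} (h : f = f') (hf : f.Monic) (hf' : f'.Monic) (g : S[X]) :
    mulCharpoly f hf g = mulCharpoly f' hf' g := by
  subst h
  rfl

/-- `p mod f` and `p` have the same class in `S[Z]/⟨f⟩` (Mathlib's `AdjoinRoot.mk_leftInverse`, restated).
[cite: Villamayor2007, 1.18 p0010 L1–L7] -/
theorem adjoinRoot_mk_modByMonic (f : S[X]) (hf : f.Monic) (p : S[X]) :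
    AdjoinRoot.mk f (p %ₘ f) = AdjoinRoot.mk f p := by
  simpa only [AdjoinRoot.modByMonicHom_mk] using AdjoinRoot.mk_leftInverse hf (AdjoinRoot.mk f p)

/-- Rank zero: `ψ_g = 1` on `S[Z]/⟨1⟩ = 0`. [cite: Villamayor2007, 1.18 p0010 L1–L7] -/
theorem mulCharpoly_one (h : (1 : S[X]).Monic) (g : S[X]) : mulCharpoly 1 h g = 1 := by
  nontriviality S
  exact ((mulCharpoly_monic _ _ _).natDegree_eq_zero).mp
    (by rw [natDegree_mulCharpoly, Polynomial.natDegree_one])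

/-- **Multiplicativity of `ψ_g` in `f`**: `ψ^{f₁f₂}_g = ψ^{f₁}_g · ψ^{f₂}_g` for monic `f₁, f₂`. Proof (the step
behind Lemma 1.19's product formula, done for an arbitrary monic factorisation instead of `F_b = ∏ (Z − Y_j)`): the
`S`-linear bijection `S[Z]/⟨f₁⟩ × S[Z]/⟨f₂⟩ → S[Z]/⟨f₁f₂⟩`, `(x̄, ȳ) ↦ (x mod f₁) + f₁·(y mod f₂)` (division algorithm)
transports the two power bases to a basis in which multiplication by `g` is block lower-triangular with diagonal
blocks the matrices of multiplication by `g` on `S[Z]/⟨f₁⟩` and `S[Z]/⟨f₂⟩`; `Matrix.charpoly_fromBlocks_zero₁₂`.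
[cite: Villamayor2007, Lemma 1.19 p0010 L9–L28] -/
theorem mulCharpoly_mul (f₁ f₂ : S[X]) (h₁ : f₁.Monic) (h₂ : f₂.Monic) (h₁₂ : (f₁ * f₂).Monic) (g : S[X]) :
    mulCharpoly (f₁ * f₂) h₁₂ g = mulCharpoly f₁ h₁ g * mulCharpoly f₂ h₂ g := by
  classical
  nontriviality S
  haveI := h₁.free_adjoinRoot; haveI := h₁.finite_adjoinRoot
  haveI := h₂.free_adjoinRoot; haveI := h₂.finite_adjoinRoot
  haveI := h₁₂.free_adjoinRoot; haveI := h₁₂.finite_adjoinRoot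
  -- the three multiplication maps
  set L := (Algebra.lmul S (AdjoinRoot (f₁ * f₂)) (AdjoinRoot.mk (f₁ * f₂) g) :
    AdjoinRoot (f₁ * f₂) →ₗ[S] AdjoinRoot (f₁ * f₂)) with hL
  set L₁ := (Algebra.lmul S (AdjoinRoot f₁) (AdjoinRoot.mk f₁ g) : AdjoinRoot f₁ →ₗ[S] AdjoinRoot f₁) with hL₁
  set L₂ := (Algebra.lmul S (AdjoinRoot f₂) (AdjoinRoot.mk f₂ g) : AdjoinRoot f₂ →ₗ[S] AdjoinRoot f₂) with hL₂
  have L_apply : ∀ p, L (AdjoinRoot.mk (f₁ * f₂) p) = AdjoinRoot.mk (f₁ * f₂) (g * p) := fun p => by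
    rw [hL, Algebra.coe_lmul_eq_mul, LinearMap.mul_apply', ← map_mul]
  have L₁_apply : ∀ p, L₁ (AdjoinRoot.mk f₁ p) = AdjoinRoot.mk f₁ (g * p) := fun p => by
    rw [hL₁, Algebra.coe_lmul_eq_mul, LinearMap.mul_apply', ← map_mul]
  have L₂_apply : ∀ p, L₂ (AdjoinRoot.mk f₂ p) = AdjoinRoot.mk f₂ (g * p) := fun p => by
    rw [hL₂, Algebra.coe_lmul_eq_mul, LinearMap.mul_apply', ← map_mul]
  -- the comparison map Ψ (x̄, ȳ) = x %ₘ f₁ + f₁·(y %ₘ f₂)  (mod f₁ f₂)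
  let mkₗ : S[X] →ₗ[S] AdjoinRoot (f₁ * f₂) := (Ideal.Quotient.mkₐ S (Ideal.span {f₁ * f₂})).toLinearMap
  have mkₗ_apply : ∀ p, mkₗ p = AdjoinRoot.mk (f₁ * f₂) p := fun p => rfl
  let Ψ : (AdjoinRoot f₁ × AdjoinRoot f₂) →ₗ[S] AdjoinRoot (f₁ * f₂) :=
    (mkₗ ∘ₗ AdjoinRoot.modByMonicHom h₁).coprod (mkₗ ∘ₗ LinearMap.mulLeft S f₁ ∘ₗ AdjoinRoot.modByMonicHom h₂)
  have Ψ_apply : ∀ p q, Ψ (AdjoinRoot.mk f₁ p, AdjoinRoot.mk f₂ q) =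
      AdjoinRoot.mk (f₁ * f₂) (p %ₘ f₁ + f₁ * (q %ₘ f₂)) := by
    intro p q
    simp only [Ψ, LinearMap.coprod_apply, LinearMap.comp_apply, AdjoinRoot.modByMonicHom_mk,
      LinearMap.mulLeft_apply, mkₗ_apply, map_add]
  have Ψ_mk_div : ∀ p, Ψ (AdjoinRoot.mk f₁ p, AdjoinRoot.mk f₂ (p /ₘ f₁)) = AdjoinRoot.mk (f₁ * f₂) p := by
    intro p
    rw [Ψ_apply, AdjoinRoot.mk_eq_mk]
    have e1 := Polynomial.modByMonic_add_div p f₁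
    have e2 := Polynomial.modByMonic_add_div (p /ₘ f₁) f₂
    exact ⟨-((p /ₘ f₁) /ₘ f₂), by linear_combination e1 + f₁ * e2⟩
  have hsurj : Function.Surjective Ψ := by
    intro z
    induction z using AdjoinRoot.induction_on with
    | ih p => exact ⟨(AdjoinRoot.mk f₁ p, AdjoinRoot.mk f₂ (p /ₘ f₁)), Ψ_mk_div p⟩
  have hinj : Function.Injective Ψ := by
    rw [injective_iff_map_eq_zero]
    rintro ⟨x, y⟩ hxy
    induction x using AdjoinRoot.induction_on with
    | ih p =>
    induction y using AdjoinRoot.induction_on with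
    | ih q =>
    rw [Ψ_apply, AdjoinRoot.mk_eq_zero] at hxy
    obtain ⟨t, ht⟩ := hxy
    have hdeg : (p %ₘ f₁).degree < f₁.degree := Polynomial.degree_modByMonic_lt p h₁
    have u1 := Polynomial.div_modByMonic_unique (q %ₘ f₂) (p %ₘ f₁) h₁ ⟨rfl, hdeg⟩
    have u2 := Polynomial.div_modByMonic_unique (f := p %ₘ f₁ + f₁ * (q %ₘ f₂)) (f₂ * t) 0 h₁
      ⟨by rw [zero_add, ← mul_assoc]; exact ht.symm, by
        rw [Polynomial.degree_zero]
        exact bot_lt_iff_ne_bot.mpr fun h => h₁.ne_zero (Polynomial.degree_eq_bot.mp h)⟩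
    have hr : p %ₘ f₁ = 0 := u1.2.symm.trans u2.2
    have hq : q %ₘ f₂ = f₂ * t := u1.1.symm.trans u2.1
    rw [Prod.mk_eq_zero]
    constructor
    · rw [← adjoinRoot_mk_modByMonic f₁ h₁, hr, map_zero]
    · rw [← adjoinRoot_mk_modByMonic f₂ h₂, hq, AdjoinRoot.mk_eq_zero]
      exact dvd_mul_right _ _
  let Φ : (AdjoinRoot f₁ × AdjoinRoot f₂) ≃ₗ[S] AdjoinRoot (f₁ * f₂) := LinearEquiv.ofBijective Ψ ⟨hinj, hsurj⟩
  have Φ_apply : ∀ z, Φ z = Ψ z := fun z => rfl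
  have Φ_symm_mk : ∀ P, Φ.symm (AdjoinRoot.mk (f₁ * f₂) P) =
      (AdjoinRoot.mk f₁ P, AdjoinRoot.mk f₂ (P /ₘ f₁)) := by
    intro P
    rw [LinearEquiv.symm_apply_eq, Φ_apply, Ψ_mk_div]
  let pb₁ := AdjoinRoot.powerBasis' h₁
  let pb₂ := AdjoinRoot.powerBasis' h₂
  let b := (pb₁.basis.prod pb₂.basis).map Φ
  have b_inl : ∀ j, b (Sum.inl j) = AdjoinRoot.mk (f₁ * f₂) (Polynomial.X ^ (j : ℕ) %ₘ f₁) := by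
    intro j
    rw [Module.Basis.map_apply, Module.Basis.prod_apply, Sum.elim_inl, Function.comp_apply, LinearMap.inl_apply,
      PowerBasis.basis_eq_pow, AdjoinRoot.powerBasis'_gen, ← AdjoinRoot.mk_X, ← map_pow,
      ← map_zero (AdjoinRoot.mk f₂), Φ_apply, Ψ_apply, Polynomial.zero_modByMonic, mul_zero, add_zero]
  have b_inr : ∀ j, b (Sum.inr j) = AdjoinRoot.mk (f₁ * f₂) (f₁ * (Polynomial.X ^ (j : ℕ) %ₘ f₂)) := by
    intro j
    rw [Module.Basis.map_apply, Module.Basis.prod_apply, Sum.elim_inr, Function.comp_apply, LinearMap.inr_apply,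
      PowerBasis.basis_eq_pow, AdjoinRoot.powerBasis'_gen, ← AdjoinRoot.mk_X, ← map_pow,
      ← map_zero (AdjoinRoot.mk f₁), Φ_apply, Ψ_apply, Polynomial.zero_modByMonic, zero_add]
  have b_repr : ∀ P i, b.repr (AdjoinRoot.mk (f₁ * f₂) P) i =
      (pb₁.basis.prod pb₂.basis).repr (AdjoinRoot.mk f₁ P, AdjoinRoot.mk f₂ (P /ₘ f₁)) i := by
    intro P i
    rw [Module.Basis.map_repr, LinearEquiv.trans_apply, Φ_symm_mk]
  have pb₁_basis : ∀ j, pb₁.basis j = AdjoinRoot.mk f₁ (Polynomial.X ^ (j : ℕ)) := fun j => by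
    rw [PowerBasis.basis_eq_pow, AdjoinRoot.powerBasis'_gen, ← AdjoinRoot.mk_X, ← map_pow]
  have pb₂_basis : ∀ j, pb₂.basis j = AdjoinRoot.mk f₂ (Polynomial.X ^ (j : ℕ)) := fun j => by
    rw [PowerBasis.basis_eq_pow, AdjoinRoot.powerBasis'_gen, ← AdjoinRoot.mk_X, ← map_pow]
  -- the matrix of L in the basis b is block lower-triangular with diagonal blocks the matrices of L₁, L₂
  set M := LinearMap.toMatrix b b L with hM
  set M₁ := LinearMap.toMatrix pb₁.basis pb₁.basis L₁ with hM₁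
  set M₂ := LinearMap.toMatrix pb₂.basis pb₂.basis L₂ with hM₂
  have hblock : M = Matrix.fromBlocks M₁ 0 (fun i j => M (Sum.inr i) (Sum.inl j)) M₂ := by
    ext i j
    rcases i with i | i <;> rcases j with j | j
    · rw [Matrix.fromBlocks_apply₁₁, hM, LinearMap.toMatrix_apply, b_inl, L_apply, b_repr,
        Module.Basis.prod_repr_inl, hM₁, LinearMap.toMatrix_apply, pb₁_basis, L₁_apply,
        RingHom.map_mul (AdjoinRoot.mk f₁) g (Polynomial.X ^ (j : ℕ) %ₘ f₁), adjoinRoot_mk_modByMonic f₁ h₁,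
        ← RingHom.map_mul]
    · rw [Matrix.fromBlocks_apply₁₂, hM, LinearMap.toMatrix_apply, b_inr, L_apply, b_repr,
        Module.Basis.prod_repr_inl, Matrix.zero_apply,
        AdjoinRoot.mk_eq_zero.mpr (dvd_mul_of_dvd_right (dvd_mul_right f₁ _) g), map_zero,
        Finsupp.zero_apply]
    · rw [Matrix.fromBlocks_apply₂₁]
    · rw [Matrix.fromBlocks_apply₂₂, hM, LinearMap.toMatrix_apply, b_inr, L_apply,
        mul_left_comm g f₁, b_repr, Module.Basis.prod_repr_inr, Polynomial.mul_divByMonic_cancel_left _ h₁, hM₂,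
        LinearMap.toMatrix_apply, pb₂_basis, L₂_apply,
        RingHom.map_mul (AdjoinRoot.mk f₂) g (Polynomial.X ^ (j : ℕ) %ₘ f₂), adjoinRoot_mk_modByMonic f₂ h₂,
        ← RingHom.map_mul]
  rw [mulCharpoly, mulCharpoly, mulCharpoly]
  change L.charpoly = L₁.charpoly * L₂.charpoly
  rw [← LinearMap.charpoly_toMatrix L b, ← hM, hblock, Matrix.charpoly_fromBlocks_zero₁₂, hM₁, hM₂,
    LinearMap.charpoly_toMatrix, LinearMap.charpoly_toMatrix]

/-- Rank one: on `S[Z]/⟨Z − α⟩ ≅ S`, multiplication by `g` is multiplication by `g(α)`, `ψ_g = T − g(α)` (the factor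
`V − Θ(Y_j)` of Lemma 1.19). [cite: Villamayor2007, Lemma 1.19 p0010 L9–L14] -/
theorem mulCharpoly_X_sub_C (α : S) (h : (Polynomial.X - Polynomial.C α).Monic) (g : S[X]) :
    mulCharpoly (Polynomial.X - Polynomial.C α) h g = Polynomial.X - Polynomial.C (g.eval α) := by
  nontriviality S
  have hg : AdjoinRoot.mk (Polynomial.X - Polynomial.C α) g =
      AdjoinRoot.mk (Polynomial.X - Polynomial.C α) (Polynomial.C (g.eval α)) := by
    rw [AdjoinRoot.mk_eq_mk, Polynomial.dvd_iff_isRoot, Polynomial.IsRoot.def, Polynomial.eval_sub,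
      Polynomial.eval_C, sub_self]
  rw [mulCharpoly_congr h hg, mulCharpoly_C, Polynomial.natDegree_X_sub_C, pow_one]

/-- **Lemma 1.19, split form** [Villamayor 2007, Lemma 1.19 p0010 L9–L14 «if `Θ = a_0 + a_1Y_1 + ⋯ + a_{b−1}Y_1^{b−1}`,
`ψ_Θ(V) = ∏_{1≤j≤b} (V − (a_0 + a_1Y_j + ⋯ + a_{b−1}Y_j^{b−1}))` (i.e., the coefficients `h_i` are, up to sign,
the symmetric polynomials evaluated at the elements `a_0 + a_1Y_j + ⋯`)»]: over ANY commutative ring `S`, if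
`f = ∏_i (Z − α_i)` then the characteristic polynomial of multiplication by `g` on `S[Z]/⟨f⟩` is `∏_i (T − g(α_i))`
(induction on the number of factors with `mulCharpoly_mul` and `mulCharpoly_X_sub_C`; the printed proof uses the
Galois group `𝕊_b` of `k[s] ⊂ k[Y]` instead). [cite: Villamayor2007, Lemma 1.19 p0010 L9–L28] -/
theorem mulCharpoly_prod_X_sub_C {n : ℕ} (α : Fin n → S)
    (h : (∏ i, (Polynomial.X - Polynomial.C (α i))).Monic) (g : S[X]) :
    mulCharpoly (∏ i, (Polynomial.X - Polynomial.C (α i))) h g =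
      ∏ i, (Polynomial.X - Polynomial.C (g.eval (α i))) := by
  induction n with
  | zero =>
    rw [mulCharpoly_eq_of_eq (Fin.prod_univ_zero _) h Polynomial.monic_one, mulCharpoly_one, Fin.prod_univ_zero]
  | succ n ih =>
    rw [mulCharpoly_eq_of_eq (Fin.prod_univ_succ _) h ((Polynomial.monic_X_sub_C _).mul
        (Polynomial.monic_prod_of_monic _ _ fun i _ => Polynomial.monic_X_sub_C _)),
      mulCharpoly_mul _ _ (Polynomial.monic_X_sub_C _)
        (Polynomial.monic_prod_of_monic _ _ fun i _ => Polynomial.monic_X_sub_C _),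
      mulCharpoly_X_sub_C, ih _ _, Fin.prod_univ_succ]

/-- Lemma 1.19, split form, factors indexed by a finite type. [cite: Villamayor2007, Lemma 1.19 p0010 L9–L28] -/
theorem mulCharpoly_prod_X_sub_C' {ι : Type w} [Fintype ι] (α : ι → S)
    (h : (∏ i, (Polynomial.X - Polynomial.C (α i))).Monic) (g : S[X]) :
    mulCharpoly (∏ i, (Polynomial.X - Polynomial.C (α i))) h g =
      ∏ i, (Polynomial.X - Polynomial.C (g.eval (α i))) := by
  classical
  have H1 : (∏ i, (Polynomial.X - Polynomial.C (α i))) =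
      ∏ j : Fin (Fintype.card ι), (Polynomial.X - Polynomial.C (α ((Fintype.equivFin ι).symm j))) :=
    Fintype.prod_equiv (Fintype.equivFin ι) _ _ fun i => by rw [Equiv.symm_apply_apply]
  have H2 : (∏ i, (Polynomial.X - Polynomial.C (g.eval (α i)))) =
      ∏ j : Fin (Fintype.card ι), (Polynomial.X - Polynomial.C (g.eval (α ((Fintype.equivFin ι).symm j)))) :=
    Fintype.prod_equiv (Fintype.equivFin ι) _ _ fun i => by rw [Equiv.symm_apply_apply]
  rw [mulCharpoly_eq_of_eq H1 h (Polynomial.monic_prod_of_monic _ _ fun i _ => Polynomial.monic_X_sub_C _),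
    mulCharpoly_prod_X_sub_C, H2]

/-- **Lemma 1.19 as printed, for the universal polynomial `F_b = ∏_j (Z − Y_j) ∈ k[Y_1,…,Y_b][Z]`**
(`UniversalElimination.univMonic`): the characteristic polynomial of multiplication by `Θ = q(Z)` on
`k[Y][Z]/⟨F_b⟩` IS the product `∏_j (V − q(Y_j))` = `CharPolyGenerators.charPolyOf ι k q` — the endomorphism
description (1.18) and the product description (Lemma 1.19) of `ψ_Θ` agree. (Over `k[s_{b,1},…,s_{b,b}] ⊂ k[Y]`
the two are compared through the injective base change, `mulCharpoly_map`.) [cite: Villamayor2007, Lemma 1.19 p0010 L9–L28] -/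
theorem mulCharpoly_univMonic {ι : Type w} [Fintype ι] {k : Type v} [CommRing k] (q : (MvPolynomial ι k)[X]) :
    mulCharpoly (univMonic ι k) univMonic_monic q = charPolyOf ι k q :=
  mulCharpoly_prod_X_sub_C' (fun i => MvPolynomial.X i) univMonic_monic q

/-- **Def. 1.21 in the form printed** [Villamayor 2007, Def. 1.21 p0010 L50–L53 «Let `H_{F_b}` be the `k`-subalgebra
… generated by the coefficients of the `b − 1` characteristic polynomials, say `ψ_{F_b^{(e)}(Y_1)}(V)`, for
`1 ≤ e ≤ b − 1`»]: `CharPolyGenerators.hSubalgebra` (typed with the product formula) is generated by the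
coefficients of the CHARACTERISTIC POLYNOMIALS OF MULTIPLICATION by the `Δ^e F_b` on `k[Y][Z]/⟨F_b⟩`, by Lemma 1.19
(`mulCharpoly_univMonic`). [cite: Villamayor2007, Def. 1.21 p0010 L50–L53] -/
theorem hSubalgebra_eq_adjoin_coeff_mulCharpoly {ι : Type w} [Fintype ι] {k : Type v} [CommRing k] :
    hSubalgebra ι k = Algebra.adjoin k {c | ∃ e n : ℕ, 1 ≤ e ∧ e + 1 ≤ Fintype.card ι ∧
      c = (mulCharpoly (univMonic ι k) univMonic_monic (univMonicDelta ι k e)).coeff n} := by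
  simp only [mulCharpoly_univMonic]
  rfl

/-- The coefficients of `ψ_{Δ^e F_b}` (`1 ≤ e ≤ b − 1`) lie in `H_{F_b}`. [cite: Villamayor2007, Def. 1.21 p0010 L50–L53] -/
theorem coeff_mulCharpoly_univMonicDelta_mem_hSubalgebra {ι : Type w} [Fintype ι] {k : Type v} [CommRing k]
    {e : ℕ} (he1 : 1 ≤ e) (he : e + 1 ≤ Fintype.card ι) (n : ℕ) :
    (mulCharpoly (univMonic ι k) univMonic_monic (univMonicDelta ι k e)).coeff n ∈ hSubalgebra ι k := by
  rw [mulCharpoly_univMonic]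
  exact coeff_charPolyOf_mem_hSubalgebra he1 he n

end Lemma119

/-! ## Orders of the coefficients (degree bookkeeping of Rem. 1.14 for `ψ_Θ`) -/

section Order

variable {S : Type u} [CommRing S]

/-- Division by a monic polynomial preserves «all coefficients in `I`»: if `p ∈ I·S[Z]` then `p mod f ∈ I·S[Z]`
(reduce modulo `I`: `Polynomial.map_modByMonic`). [cite: Villamayor2007, Rem. 1.14 p0008 L138–L147] -/
theorem coeff_modByMonic_mem (I : Ideal S) {p : S[X]} (hp : ∀ i, p.coeff i ∈ I) {f : S[X]} (hf : f.Monic)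
    (i : ℕ) : (p %ₘ f).coeff i ∈ I := by
  have hp0 : p.map (Ideal.Quotient.mk I) = 0 := by
    ext n
    rw [Polynomial.coeff_map, Polynomial.coeff_zero, Ideal.Quotient.eq_zero_iff_mem]
    exact hp n
  have h : (p %ₘ f).map (Ideal.Quotient.mk I) = 0 := by
    rw [Polynomial.map_modByMonic _ hf, hp0, Polynomial.zero_modByMonic]
  rw [← Ideal.Quotient.eq_zero_iff_mem, ← Polynomial.coeff_map, h, Polynomial.coeff_zero]

/-- **Orders of the coefficients of `ψ_g`, unweighted form** (the degree bookkeeping of Rem. 1.14 / 1.15 p0008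
L138–p0009 L16 «`φ(F) ∈ S` has order at least `n` at `𝒪_{V^{(d−1)},x}`» applied to the characteristic
polynomial of 1.18): if every coefficient of `g` lies in an ideal `I ⊂ S`, then the coefficient of `T^k` in `ψ_g`
lies in `I^{deg f − k}` — the matrix of multiplication by `g` has all its entries in `I`
(`toMatrix_lmul_mk_apply`, `coeff_modByMonic_mem`) and `Matrix.coeff_charpoly_mem_ideal_pow`.
[cite: Villamayor2007, Rem. 1.14 p0008 L138–L147] -/
theorem coeff_mulCharpoly_mem_pow (f : S[X]) (hf : f.Monic) (I : Ideal S) {g : S[X]} (hg : ∀ i, g.coeff i ∈ I)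
    (k : ℕ) : (mulCharpoly f hf g).coeff k ∈ I ^ (f.natDegree - k) := by
  classical
  haveI := hf.free_adjoinRoot
  haveI := hf.finite_adjoinRoot
  have h := Matrix.coeff_charpoly_mem_ideal_pow (I := I)
    (M := LinearMap.toMatrix (AdjoinRoot.powerBasis' hf).basis (AdjoinRoot.powerBasis' hf).basis
      (Algebra.lmul S (AdjoinRoot f) (AdjoinRoot.mk f g))) (fun i j => by
        rw [toMatrix_lmul_mk_apply]
        refine coeff_modByMonic_mem I (fun l => ?_) hf _
        rw [Polynomial.coeff_mul_X_pow']
        split_ifs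
        · exact hg _
        · exact I.zero_mem) k
  rwa [LinearMap.charpoly_toMatrix, Fintype.card_fin, AdjoinRoot.powerBasis'_dim] at h

end Order

/-! ## The weights of (2.8.1): `ψ_{c·g}` is `ψ_g` with roots scaled by `c` -/

section Scale

variable {S : Type u} [CommRing S]

/-- Matrix form: `charpoly(c·M)(cT) = c^n · charpoly(M)(T)`. [cite: BravoVillamayor2010, Par. 2.8 (2.8.1)] -/
theorem charpoly_smul_comp_C_mul_X {n : Type w} [Fintype n] [DecidableEq n] (M : Matrix n n S) (c : S) :
    (c • M).charpoly.comp (Polynomial.C c * Polynomial.X) = Polynomial.C c ^ Fintype.card n * M.charpoly := by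
  have h1 : (c • M).charpoly.comp (Polynomial.C c * Polynomial.X) =
      ((Polynomial.eval₂RingHom Polynomial.C (Polynomial.C c * Polynomial.X)).mapMatrix
        (Matrix.charmatrix (c • M))).det := by
    rw [Matrix.charpoly, ← RingHom.map_det]
    rfl
  have h2 : (Polynomial.eval₂RingHom Polynomial.C (Polynomial.C c * Polynomial.X)).mapMatrix
      (Matrix.charmatrix (c • M)) = Polynomial.C c • Matrix.charmatrix M := by
    ext i j
    rw [RingHom.mapMatrix_apply, Matrix.map_apply, Matrix.smul_apply, smul_eq_mul, Polynomial.coe_eval₂RingHom,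
      ← Polynomial.comp]
    by_cases hij : i = j
    · subst hij
      rw [Matrix.charmatrix_apply_eq, Matrix.charmatrix_apply_eq, Matrix.smul_apply, smul_eq_mul,
        Polynomial.sub_comp, Polynomial.X_comp, Polynomial.C_comp, map_mul, mul_sub]
    · rw [Matrix.charmatrix_apply_ne _ _ _ hij, Matrix.charmatrix_apply_ne _ _ _ hij, Matrix.smul_apply,
        smul_eq_mul, Polynomial.neg_comp, Polynomial.C_comp, map_mul, mul_neg]
  rw [h1, h2, Matrix.det_smul, Matrix.charpoly]

/-- `ψ_{c·g}(cT) = c^{deg f}·ψ_g(T)`: multiplication by `c·g` is `c·L_g`. [cite: BravoVillamayor2010, Par. 2.8 (2.8.1)] -/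
theorem mulCharpoly_C_mul_comp (f : S[X]) (hf : f.Monic) (g : S[X]) (c : S) :
    (mulCharpoly f hf (Polynomial.C c * g)).comp (Polynomial.C c * Polynomial.X) =
      Polynomial.C c ^ f.natDegree * mulCharpoly f hf g := by
  classical
  haveI := hf.free_adjoinRoot
  haveI := hf.finite_adjoinRoot
  have hL : Algebra.lmul S (AdjoinRoot f) (AdjoinRoot.mk f (Polynomial.C c * g)) =
      c • Algebra.lmul S (AdjoinRoot f) (AdjoinRoot.mk f g) := by
    rw [map_mul, AdjoinRoot.mk_C, ← AdjoinRoot.algebraMap_eq, map_mul, AlgHom.commutes, ← Algebra.smul_def]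
  rw [mulCharpoly, mulCharpoly, ← LinearMap.charpoly_toMatrix _ (AdjoinRoot.powerBasis' hf).basis,
    ← LinearMap.charpoly_toMatrix (Algebra.lmul S (AdjoinRoot f) (AdjoinRoot.mk f g))
      (AdjoinRoot.powerBasis' hf).basis, hL, LinearEquiv.map_smul, charpoly_smul_comp_C_mul_X, Fintype.card_fin]
  simp only [AdjoinRoot.powerBasis'_dim]

/-- `scaleRoots` has the same composition property: `(scaleRoots p c)(cT) = c^{deg p}·p(T)`.
[cite: BravoVillamayor2010, Par. 2.8 (2.8.1)] -/
theorem scaleRoots_comp_C_mul_X (p : S[X]) (c : S) :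
    (p.scaleRoots c).comp (Polynomial.C c * Polynomial.X) = Polynomial.C c ^ p.natDegree * p := by
  rw [Polynomial.comp, Polynomial.scaleRoots_eval₂_mul, ← map_pow, Polynomial.eval₂_C_X]

/-- **The weights of (2.8.1): `ψ_{c·g}` is `ψ_g` with roots scaled by `c`**
[Bravo–Villamayor 2010, Par. 2.8 (2.8.1) «multiplying by an element `f_{n_i}W^{n_i}` induces an endomorphism … a
characteristic polynomial of degree `n`, `T^n + g_{1,n_i}T^{n−1} + … + g_{n,n_i}` where `g_{j,n_i} ∈ 𝒪[W]`»]: for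
every `c ∈ S`, `ψ_{c·g}(T) = Σ_k ψ_{g,k} c^{deg f − k} T^k` (`Polynomial.scaleRoots`); with `S ← S[W]`, `c = W^n`
(`mulCharpoly_map` along `S → S[W]`) the coefficient of `T^{deg f − j}` of the characteristic polynomial of
multiplication by `g·W^n` is `ψ_{g,deg f − j}·W^{jn}` — the weights used in `mulCharpolyRees`. Proof by the
generic element: over `S[u]` both sides agree after `T ↦ uT` (`mulCharpoly_C_mul_comp`,
`scaleRoots_comp_C_mul_X`), `u` is a non-zero-divisor, then specialise `u ↦ c` (`mulCharpoly_map`).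
[cite: BravoVillamayor2010, Par. 2.8 (2.8.1)] -/
theorem mulCharpoly_C_mul (f : S[X]) (hf : f.Monic) (g : S[X]) (c : S) :
    mulCharpoly f hf (Polynomial.C c * g) = (mulCharpoly f hf g).scaleRoots c := by
  nontriviality S
  -- the generic case: base ring `S[u]`, constant `u`
  have key : mulCharpoly (f.map Polynomial.C) (hf.map _) (Polynomial.C Polynomial.X * g.map Polynomial.C) =
      (mulCharpoly (f.map Polynomial.C) (hf.map _) (g.map Polynomial.C)).scaleRoots Polynomial.X := by
    rw [← sub_eq_zero, ← Polynomial.comp_C_mul_X_eq_zero_iff Polynomial.monic_X.mem_nonZeroDivisors,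
      Polynomial.sub_comp, mulCharpoly_C_mul_comp, scaleRoots_comp_C_mul_X, natDegree_mulCharpoly,
      hf.natDegree_map, sub_self]
  -- specialise `u ↦ c`
  have hC : (Polynomial.evalRingHom c).comp Polynomial.C = RingHom.id S := by
    ext s
    simp
  have hfC : (f.map Polynomial.C).map (Polynomial.evalRingHom c) = f := by
    rw [Polynomial.map_map, hC, Polynomial.map_id]
  have hgC : (g.map Polynomial.C).map (Polynomial.evalRingHom c) = g := by
    rw [Polynomial.map_map, hC, Polynomial.map_id]
  have h := congrArg (Polynomial.map (Polynomial.evalRingHom c)) key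
  rw [mulCharpoly_map, Polynomial.map_scaleRoots _ _ _ (by
      rw [(mulCharpoly_monic _ _ _).leadingCoeff, map_one]; exact one_ne_zero),
    mulCharpoly_map, Polynomial.map_mul, Polynomial.map_C, Polynomial.coe_evalRingHom, Polynomial.eval_X, hgC,
    mulCharpoly_eq_of_eq hfC _ hf, mulCharpoly_eq_of_eq hfC _ hf] at h
  exact h

/-- `C a` is a non-zero-divisor of `S[X]` when `a` is one of `S`. [cite: BravoVillamayor2010, Par. 2.8 (2.8.1)] -/
theorem C_mem_nonZeroDivisors {a : S} (ha : a ∈ nonZeroDivisors S) : Polynomial.C a ∈ nonZeroDivisors S[X] :=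
  Polynomial.mem_nonZeroDivisors_of_leadingCoeff (by rwa [Polynomial.leadingCoeff_C])

/-- `ψ` on `S[Z]/⟨f⟩` evaluated at the class of `q`: `aeval (q̄) p = (p ∘ q)‾`. [cite: Villamayor2007, 1.18 p0010 L1–L7] -/
theorem aeval_mk_eq_mk_comp (f p q : S[X]) :
    Polynomial.aeval (AdjoinRoot.mk f q) p = AdjoinRoot.mk f (p.comp q) := by
  rw [← AdjoinRoot.aeval_eq (f := f) (p.comp q), Polynomial.aeval_comp, AdjoinRoot.aeval_eq]

/-- **Intertwined endomorphisms have the same characteristic polynomial** when the intertwiner's matrix has a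
non-zero-divisor determinant: if `σ ∘ L₁ = L₂ ∘ σ` for `σ : M₁ → M₂` between free modules of the same rank and
`det(σ)` (in any bases) is a non-zero-divisor, then `χ_{L₁} = χ_{L₂}` (`(T − [L₂])·[σ] = [σ]·(T − [L₁])`, take
determinants and cancel). Linear-algebra helper for the change-of-variable lemmas below.
[cite: Villamayor2007, 1.18 p0010 L1–L7] -/
theorem charpoly_eq_of_semiconj {M₁ M₂ : Type*} [AddCommGroup M₁] [Module S M₁] [AddCommGroup M₂] [Module S M₂]
    [Module.Free S M₁] [Module.Finite S M₁] [Module.Free S M₂] [Module.Finite S M₂] {d₁ d₂ : ℕ}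
    (b₁ : Module.Basis (Fin d₁) S M₁) (b₂ : Module.Basis (Fin d₂) S M₂) (hd : d₁ = d₂) (σ : M₁ →ₗ[S] M₂)
    (L₁ : M₁ →ₗ[S] M₁) (L₂ : M₂ →ₗ[S] M₂) (hσ : σ ∘ₗ L₁ = L₂ ∘ₗ σ)
    (hdet : ((LinearMap.toMatrix b₁ b₂ σ).submatrix id (finCongr hd).symm).det ∈ nonZeroDivisors S) :
    L₁.charpoly = L₂.charpoly := by
  classical
  set e : Fin d₁ ≃ Fin d₂ := finCongr hd with he
  set D := LinearMap.toMatrix b₁ b₂ σ with hD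
  set M₁' := LinearMap.toMatrix b₁ b₁ L₁ with hM₁'
  set M₂' := LinearMap.toMatrix b₂ b₂ L₂ with hM₂'
  have hDM : D * M₁' = M₂' * D := by
    rw [hD, hM₁', hM₂', ← LinearMap.toMatrix_comp, ← LinearMap.toMatrix_comp, hσ]
  set M₁'' := Matrix.reindex e e M₁' with hM₁''
  have hDM₀ : D.submatrix id e.symm * M₁'' = M₂' * D.submatrix id e.symm := by
    rw [hM₁'', Matrix.reindex_apply, Matrix.submatrix_mul_equiv, hDM,
      ← Matrix.submatrix_mul_equiv M₂' D _ (Equiv.refl _) _]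
    rfl
  have hchar : Matrix.charmatrix M₂' * (D.submatrix id e.symm).map Polynomial.C =
      (D.submatrix id e.symm).map Polynomial.C * Matrix.charmatrix M₁'' := by
    rw [Matrix.charmatrix, Matrix.charmatrix, sub_mul, mul_sub, (Matrix.scalar_commute _ (Commute.all _) _).eq,
      ← RingHom.mapMatrix_apply, ← map_mul, ← map_mul, ← hDM₀]
  have hdet' : (Matrix.det ((D.submatrix id e.symm).map Polynomial.C) : S[X]) ∈ nonZeroDivisors S[X] := by
    rw [← RingHom.mapMatrix_apply, ← RingHom.map_det]
    exact C_mem_nonZeroDivisors hdet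
  have hcp : M₂'.charpoly = M₁''.charpoly := by
    have h := congrArg Matrix.det hchar
    rw [Matrix.det_mul, Matrix.det_mul, ← Matrix.charpoly, ← Matrix.charpoly,
      mul_comm (Matrix.det _) M₁''.charpoly] at h
    exact (mul_cancel_right_mem_nonZeroDivisors hdet').mp h
  rw [← LinearMap.charpoly_toMatrix L₁ b₁, ← LinearMap.charpoly_toMatrix L₂ b₂, ← hM₁', ← hM₂', hcp, hM₁'',
    Matrix.charpoly_reindex]

/-- **Homothety `Z ↦ uZ`**: for a non-zero-divisor `u ∈ S`, the characteristic polynomial of multiplication by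
`g'` on `S[Z]/⟨u^{b} f(Z/u)⟩` (`Polynomial.scaleRoots f u`) equals that of multiplication by `u^n·g` on `S[Z]/⟨f⟩`
whenever `g'(uZ) = u^n g(Z)` (the algebra map `Z ↦ uZ` intertwines the two multiplications; its matrix
`diag(u^i)` has non-zero-divisor determinant). Used with `S ← S[u]` to move `I`-adic weights into the Rees algebra.
[cite: BravoVillamayor2010, Par. 2.8 (2.8.1)] -/
theorem mulCharpoly_scaleRoots (f : S[X]) (hf : f.Monic) {u : S} (hu : u ∈ nonZeroDivisors S)
    (hfu : (f.scaleRoots u).Monic) {n : ℕ} (g g' : S[X])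
    (hg' : g'.comp (Polynomial.C u * Polynomial.X) = Polynomial.C (u ^ n) * g) :
    mulCharpoly (f.scaleRoots u) hfu g' = mulCharpoly f hf (Polynomial.C (u ^ n) * g) := by
  classical
  nontriviality S
  haveI := hf.free_adjoinRoot
  haveI := hf.finite_adjoinRoot
  haveI := hfu.free_adjoinRoot
  haveI := hfu.finite_adjoinRoot
  -- the algebra map `σ : S[Z]/⟨f_u⟩ → S[Z]/⟨f⟩`, `Z ↦ uZ`
  have hroot : Polynomial.aeval (AdjoinRoot.mk f (Polynomial.C u * Polynomial.X)) (f.scaleRoots u) = 0 := by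
    rw [aeval_mk_eq_mk_comp, scaleRoots_comp_C_mul_X, AdjoinRoot.mk_eq_zero]
    exact dvd_mul_left f _
  let σ : AdjoinRoot (f.scaleRoots u) →ₐ[S] AdjoinRoot f :=
    AdjoinRoot.liftAlgHom (f.scaleRoots u) (Algebra.ofId S (AdjoinRoot f))
      (AdjoinRoot.mk f (Polynomial.C u * Polynomial.X)) (show Polynomial.aeval _ _ = 0 from hroot)
  have σ_mk : ∀ p, σ (AdjoinRoot.mk _ p) = AdjoinRoot.mk f (p.comp (Polynomial.C u * Polynomial.X)) := by
    intro p
    rw [AdjoinRoot.liftAlgHom_mk]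
    exact aeval_mk_eq_mk_comp f p _
  set L' := (Algebra.lmul S (AdjoinRoot (f.scaleRoots u)) (AdjoinRoot.mk _ g') :
    AdjoinRoot (f.scaleRoots u) →ₗ[S] AdjoinRoot (f.scaleRoots u)) with hL'
  set L := (Algebra.lmul S (AdjoinRoot f) (AdjoinRoot.mk f (Polynomial.C (u ^ n) * g)) :
    AdjoinRoot f →ₗ[S] AdjoinRoot f) with hL
  have hσL : σ.toLinearMap ∘ₗ L' = L ∘ₗ σ.toLinearMap := by
    apply LinearMap.ext
    intro x
    induction x using AdjoinRoot.induction_on with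
    | ih p =>
      rw [LinearMap.comp_apply, LinearMap.comp_apply, AlgHom.toLinearMap_apply, AlgHom.toLinearMap_apply, hL',
        hL, Algebra.coe_lmul_eq_mul, LinearMap.mul_apply', Algebra.coe_lmul_eq_mul, LinearMap.mul_apply',
        ← map_mul, σ_mk, σ_mk, ← map_mul, Polynomial.mul_comp, hg']
  -- the matrix of `σ` in the power bases is `diag(u^j)`
  set pb' := AdjoinRoot.powerBasis' hfu
  set pb := AdjoinRoot.powerBasis' hf
  have hdim : pb'.dim = pb.dim := by
    rw [AdjoinRoot.powerBasis'_dim, AdjoinRoot.powerBasis'_dim, Polynomial.natDegree_scaleRoots]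
  have pb_basis : ∀ j : Fin pb.dim, pb.basis j = AdjoinRoot.mk f (Polynomial.X ^ (j : ℕ)) := fun j => by
    rw [PowerBasis.basis_eq_pow, AdjoinRoot.powerBasis'_gen, ← AdjoinRoot.mk_X, ← map_pow]
  have pb'_basis : ∀ j : Fin pb'.dim, pb'.basis j = AdjoinRoot.mk _ (Polynomial.X ^ (j : ℕ)) := fun j => by
    rw [PowerBasis.basis_eq_pow, AdjoinRoot.powerBasis'_gen, ← AdjoinRoot.mk_X, ← map_pow]
  have hD₀ : (LinearMap.toMatrix pb'.basis pb.basis σ.toLinearMap).submatrix id (finCongr hdim).symm =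
      Matrix.diagonal fun j : Fin pb.dim => u ^ (j : ℕ) := by
    ext i j
    rw [Matrix.submatrix_apply, id, LinearMap.toMatrix_apply, AlgHom.toLinearMap_apply, pb'_basis, σ_mk,
      finCongr_symm, finCongr_apply_coe, Polynomial.pow_comp, Polynomial.X_comp, mul_pow, ← map_pow,
      map_mul, AdjoinRoot.mk_C, ← AdjoinRoot.algebraMap_eq, ← Algebra.smul_def, ← pb_basis j, map_smul,
      Module.Basis.repr_self, Finsupp.smul_apply, Finsupp.single_apply, Matrix.diagonal_apply]
    split_ifs with h1 h2 h2
    · rw [smul_eq_mul, mul_one, h2]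
    · exact absurd h1.symm h2
    · exact absurd h2.symm h1
    · rw [smul_zero]
  have hdet : ((LinearMap.toMatrix pb'.basis pb.basis σ.toLinearMap).submatrix id (finCongr hdim).symm).det ∈
      nonZeroDivisors S := by
    rw [hD₀, Matrix.det_diagonal]
    exact prod_mem fun j _ => pow_mem hu _
  rw [mulCharpoly, mulCharpoly]
  change L'.charpoly = L.charpoly
  exact charpoly_eq_of_semiconj pb'.basis pb.basis hdim σ.toLinearMap L' L hσL hdet

/-- `taylor` preserves monicity. [cite: Villamayor2007, §1.5 p0007 L57–L60] -/
theorem monic_taylor {f : S[X]} (hf : f.Monic) (s : S) : (Polynomial.taylor s f).Monic := by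
  change (Polynomial.taylor s f).leadingCoeff = 1
  rw [Polynomial.leadingCoeff_taylor]
  exact hf

/-- **Translation `Z ↦ Z + s` does not change `ψ`** (§1.5 p0007 L57–L60 «a change of variable `Z_1 = Z − s`» does
not affect the extension): `ψ^{f(Z+s)}_{g(Z+s)} = ψ^{f}_{g}` — the algebra isomorphism `S[Z]/⟨f(Z+s)⟩ ≅ S[Z]/⟨f⟩`
intertwines the two multiplications (`charpoly_eq_of_semiconj` with an invertible matrix).
[cite: Villamayor2007, §1.5 p0007 L57–L60] -/
theorem mulCharpoly_taylor (f : S[X]) (hf : f.Monic) (s : S) (hft : (Polynomial.taylor s f).Monic) (g : S[X]) :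
    mulCharpoly (Polynomial.taylor s f) hft (Polynomial.taylor s g) = mulCharpoly f hf g := by
  classical
  nontriviality S
  haveI := hf.free_adjoinRoot
  haveI := hf.finite_adjoinRoot
  haveI := hft.free_adjoinRoot
  haveI := hft.finite_adjoinRoot
  have hXs : (Polynomial.X + Polynomial.C s).comp (Polynomial.X - Polynomial.C s) = (Polynomial.X : S[X]) := by
    rw [Polynomial.add_comp, Polynomial.X_comp, Polynomial.C_comp, sub_add_cancel]
  have hXs' : (Polynomial.X - Polynomial.C s).comp (Polynomial.X + Polynomial.C s) = (Polynomial.X : S[X]) := by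
    rw [Polynomial.sub_comp, Polynomial.X_comp, Polynomial.C_comp, add_sub_cancel_right]
  -- `σ : Z ↦ Z − s` and its inverse `τ : Z ↦ Z + s`
  have hσ0 : Polynomial.aeval (AdjoinRoot.mk f (Polynomial.X - Polynomial.C s)) (Polynomial.taylor s f) = 0 := by
    rw [aeval_mk_eq_mk_comp, Polynomial.taylor_apply, Polynomial.comp_assoc, hXs, Polynomial.comp_X,
      AdjoinRoot.mk_self]
  have hτ0 : Polynomial.aeval (AdjoinRoot.mk (Polynomial.taylor s f) (Polynomial.X + Polynomial.C s)) f = 0 := by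
    rw [aeval_mk_eq_mk_comp, ← Polynomial.taylor_apply, AdjoinRoot.mk_self]
  let σ : AdjoinRoot (Polynomial.taylor s f) →ₐ[S] AdjoinRoot f :=
    AdjoinRoot.liftAlgHom _ (Algebra.ofId S (AdjoinRoot f)) _ (show Polynomial.aeval _ _ = 0 from hσ0)
  let τ : AdjoinRoot f →ₐ[S] AdjoinRoot (Polynomial.taylor s f) :=
    AdjoinRoot.liftAlgHom _ (Algebra.ofId S _) _ (show Polynomial.aeval _ _ = 0 from hτ0)
  have σ_mk : ∀ p, σ (AdjoinRoot.mk _ p) = AdjoinRoot.mk f (p.comp (Polynomial.X - Polynomial.C s)) := by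
    intro p
    rw [AdjoinRoot.liftAlgHom_mk]
    exact aeval_mk_eq_mk_comp f p _
  have τ_mk : ∀ p, τ (AdjoinRoot.mk f p) = AdjoinRoot.mk _ (p.comp (Polynomial.X + Polynomial.C s)) := by
    intro p
    rw [AdjoinRoot.liftAlgHom_mk]
    exact aeval_mk_eq_mk_comp _ p _
  have hστ : σ.comp τ = AlgHom.id S (AdjoinRoot f) := by
    refine AdjoinRoot.algHom_ext ?_
    rw [AlgHom.comp_apply, AlgHom.id_apply, ← AdjoinRoot.mk_X, τ_mk, σ_mk, Polynomial.X_comp, hXs]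
  set L' := (Algebra.lmul S (AdjoinRoot (Polynomial.taylor s f)) (AdjoinRoot.mk _ (Polynomial.taylor s g)) :
    AdjoinRoot (Polynomial.taylor s f) →ₗ[S] AdjoinRoot (Polynomial.taylor s f)) with hL'
  set L := (Algebra.lmul S (AdjoinRoot f) (AdjoinRoot.mk f g) : AdjoinRoot f →ₗ[S] AdjoinRoot f) with hL
  have hσL : σ.toLinearMap ∘ₗ L' = L ∘ₗ σ.toLinearMap := by
    apply LinearMap.ext
    intro x
    induction x using AdjoinRoot.induction_on with
    | ih p =>
      rw [LinearMap.comp_apply, LinearMap.comp_apply, AlgHom.toLinearMap_apply, AlgHom.toLinearMap_apply, hL',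
        hL, Algebra.coe_lmul_eq_mul, LinearMap.mul_apply', Algebra.coe_lmul_eq_mul, LinearMap.mul_apply',
        ← map_mul, σ_mk, σ_mk, ← map_mul, Polynomial.mul_comp, Polynomial.taylor_apply, Polynomial.comp_assoc,
        hXs, Polynomial.comp_X]
  set pb' := AdjoinRoot.powerBasis' hft
  set pb := AdjoinRoot.powerBasis' hf
  have hdim : pb'.dim = pb.dim := by
    rw [AdjoinRoot.powerBasis'_dim, AdjoinRoot.powerBasis'_dim, Polynomial.natDegree_taylor]
  -- the matrix of `σ` is invertible (inverse: the matrix of `τ`), so its determinant is a unit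
  have hdet : ((LinearMap.toMatrix pb'.basis pb.basis σ.toLinearMap).submatrix id (finCongr hdim).symm).det ∈
      nonZeroDivisors S := by
    apply IsUnit.mem_nonZeroDivisors
    apply IsUnit.of_mul_eq_one ((LinearMap.toMatrix pb.basis pb'.basis τ.toLinearMap).submatrix
      (finCongr hdim).symm id).det
    rw [← Matrix.det_mul, Matrix.submatrix_mul_equiv, ← LinearMap.toMatrix_comp]
    have : σ.toLinearMap ∘ₗ τ.toLinearMap = LinearMap.id := by
      rw [← AlgHom.comp_toLinearMap, hστ]
      rfl
    rw [this, LinearMap.toMatrix_id]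
    change Matrix.det (1 : Matrix (Fin pb.dim) (Fin pb.dim) S) = 1
    exact Matrix.det_one
  rw [mulCharpoly, mulCharpoly]
  change L'.charpoly = L.charpoly
  exact charpoly_eq_of_semiconj pb'.basis pb.basis hdim σ.toLinearMap L' L hσL hdet

end Scale

/-! ## Weighted orders: a `b`-fold point of `f` at `Z = 0` along `I` and `g·W^n` of weighted order `≥ n` -/

section Weighted

variable {S : Type u} [CommRing S]

/-- `a·u^m` lies in the Rees algebra `⊕ I^m u^m` when `a ∈ I^m`. [cite: Villamayor2007, Rem. 1.14 p0008 L138–L147] -/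
theorem C_mul_X_pow_mem_reesAlgebra (I : Ideal S) {a : S} {m : ℕ} (ha : a ∈ I ^ m) :
    Polynomial.C a * Polynomial.X ^ m ∈ reesAlgebra I := by
  rw [mem_reesAlgebra_iff]
  intro i
  rw [Polynomial.coeff_C_mul_X_pow]
  split_ifs with h
  · subst h
    exact ha
  · exact Ideal.zero_mem _

/-- **Weighted orders of the coefficients of `ψ_g`** (the degree bookkeeping of Rem. 1.14 / 1.15 and Thm. 1.16
(ii) p0008 L138–p0009 L53, for the characteristic polynomials of 1.18 / (2.8.1)): let `I ⊂ S` be an ideal and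
suppose `f = Z^b + a_1Z^{b−1} + ⋯ + a_b` has `a_i ∈ I^i` («`f` has a `b`-fold point at `Z = 0` along `I`», the
ideal form `f ∈ (I·S[Z] + ⟨Z⟩)^b` of `OrderAlongSection.mem_pow_sup_span_X_iff`) and `g = Σ_{l ≤ n} g_l Z^l` has
`g_l ∈ I^{n−l}` (`g·W^n` has weighted order `≥ n`). Then the coefficient of `T^k` in `ψ_g` lies in
`I^{n(b−k)}`: the generator `ψ_{g,b−j}·W^{jn}` of `mulCharpolyRees f g n` has order `≥ jn` along `I`. Proof: over
`S[u]`, `u^b f(Z/u)` and `u^n g(Z/u)` have coefficients in the Rees algebra `⊕ I^m u^m` (Mathlib's `reesAlgebra`),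
hence so does their `ψ` (`mulCharpoly_map`), which by the homothety `Z ↦ uZ` (`mulCharpoly_scaleRoots`) and
`mulCharpoly_C_mul` is `Σ_k ψ_{g,k} u^{n(b−k)} T^k`. [cite: Villamayor2007, Rem. 1.15 / Thm. 1.16 (ii) p0009 L1–L53] -/
theorem coeff_mulCharpoly_mem_pow_of_weights (I : Ideal S) (f : S[X]) (hf : f.Monic)
    (hfI : ∀ l, f.coeff l ∈ I ^ (f.natDegree - l)) {g : S[X]} {n : ℕ} (hgn : g.natDegree ≤ n)
    (hgI : ∀ l, g.coeff l ∈ I ^ (n - l)) (k : ℕ) :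
    (mulCharpoly f hf g).coeff k ∈ I ^ (n * (f.natDegree - k)) := by
  classical
  nontriviality S
  -- `f_u := u^b f(Z/u)` and `g_u := u^n g(Z/u)` over `S[u]`
  have hfu : ((f.map Polynomial.C).scaleRoots Polynomial.X).Monic :=
    (Polynomial.monic_scaleRoots_iff _).mpr (hf.map _)
  set gu : S[X][X] := ∑ l ∈ Finset.range (n + 1),
    Polynomial.C (Polynomial.C (g.coeff l) * Polynomial.X ^ (n - l)) * Polynomial.X ^ l with hgu_def
  have gu_coeff : ∀ m, gu.coeff m =
      if m ≤ n then Polynomial.C (g.coeff m) * Polynomial.X ^ (n - m) else 0 := by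
    intro m
    rw [hgu_def, Polynomial.finsetSum_coeff]
    simp_rw [Polynomial.coeff_C_mul_X_pow]
    rw [Finset.sum_ite_eq]
    simp only [Finset.mem_range, Nat.lt_succ_iff]
  have hgu : gu.comp (Polynomial.C Polynomial.X * Polynomial.X) =
      Polynomial.C (Polynomial.X ^ n) * g.map Polynomial.C := by
    ext m : 1
    rw [Polynomial.comp_C_mul_X_coeff, gu_coeff, Polynomial.coeff_C_mul, Polynomial.coeff_map]
    split_ifs with h
    · rw [mul_assoc, ← pow_add, Nat.sub_add_cancel h, mul_comm]
    · rw [zero_mul, Polynomial.coeff_eq_zero_of_natDegree_lt (lt_of_le_of_lt hgn (not_le.mp h)), map_zero,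
        mul_zero]
  -- both have coefficients in the Rees algebra `𝓡 = ⊕ I^m u^m`
  have hfu_mem : ∀ l, ((f.map Polynomial.C).scaleRoots Polynomial.X).coeff l ∈ reesAlgebra I := by
    intro l
    rw [Polynomial.coeff_scaleRoots, Polynomial.coeff_map, hf.natDegree_map]
    exact C_mul_X_pow_mem_reesAlgebra I (hfI l)
  have hgu_mem : ∀ m, gu.coeff m ∈ reesAlgebra I := by
    intro m
    rw [gu_coeff]
    split_ifs
    · exact C_mul_X_pow_mem_reesAlgebra I (hgI m)
    · exact Subalgebra.zero_mem _
  have hrange : ∀ q : S[X], q ∈ reesAlgebra I → q ∈ Set.range ((reesAlgebra I).val : reesAlgebra I →+* S[X]) :=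
    fun q hq => ⟨⟨q, hq⟩, rfl⟩
  obtain ⟨f₀, hf₀, -, hf₀m⟩ := Polynomial.lifts_and_natDegree_eq_and_monic
    ((Polynomial.lifts_iff_coeff_lifts _).mpr fun l => hrange _ (hfu_mem l)) hfu
  obtain ⟨g₀, hg₀⟩ := (Polynomial.mem_lifts _).mp ((Polynomial.lifts_iff_coeff_lifts _).mpr fun m => hrange _ (hgu_mem m))
  -- `ψ` over `𝓡` maps to `ψ^{f_u}_{g_u} = Σ_k ψ_{g,k} u^{n(b-k)} T^k`
  have hψ := mulCharpoly_map ((reesAlgebra I).val : reesAlgebra I →+* S[X]) f₀ hf₀m g₀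
  have hX : (Polynomial.X : S[X]) ∈ nonZeroDivisors S[X] := Polynomial.monic_X.mem_nonZeroDivisors
  have hsc := @mulCharpoly_scaleRoots S[X] _ (f.map Polynomial.C) (hf.map Polynomial.C) Polynomial.X hX hfu n
    (g.map Polynomial.C) gu hgu
  rw [hg₀, mulCharpoly_eq_of_eq hf₀ _ hfu, hsc, mulCharpoly_C_mul, ← mulCharpoly_map Polynomial.C f hf g] at hψ
  -- read off the coefficient of `T^k`
  have hk := congrArg (fun q => Polynomial.coeff q k) hψ
  simp only [Polynomial.coeff_map, Polynomial.coeff_scaleRoots] at hk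
  rw [(mulCharpoly_monic f hf g).natDegree_map, natDegree_mulCharpoly, ← pow_mul] at hk
  have hmem : Polynomial.C ((mulCharpoly f hf g).coeff k) * Polynomial.X ^ (n * (f.natDegree - k)) ∈
      reesAlgebra I := by
    rw [← hk]
    exact Subtype.coe_prop _
  have := (mem_reesAlgebra_iff I _).mp hmem (n * (f.natDegree - k))
  rwa [Polynomial.coeff_C_mul_X_pow, if_pos rfl] at this

/-- **Weighted orders at a `b`-fold point `Z = s`** (the hypothesis of Thm. 1.16 (ii) in the ideal form of
`OrderAlongSection`: the Taylor coefficients of `f` at `s` satisfy `a_i(s) ∈ I^i`, those of `g` satisfy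
`g_l(s) ∈ I^{n−l}`): the coefficient of `T^k` in `ψ_g` lies in `I^{n(deg f − k)}` — by translation invariance
`mulCharpoly_taylor` and the case `s = 0`. [cite: Villamayor2007, Thm. 1.16 (ii) p0009 L20–L53] -/
theorem coeff_mulCharpoly_mem_pow_of_weights_taylor (I : Ideal S) (f : S[X]) (hf : f.Monic) (s : S)
    (hfI : ∀ l, (Polynomial.taylor s f).coeff l ∈ I ^ (f.natDegree - l)) {g : S[X]} {n : ℕ}
    (hgn : g.natDegree ≤ n) (hgI : ∀ l, (Polynomial.taylor s g).coeff l ∈ I ^ (n - l)) (k : ℕ) :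
    (mulCharpoly f hf g).coeff k ∈ I ^ (n * (f.natDegree - k)) := by
  rw [← mulCharpoly_taylor f hf s (monic_taylor hf s) g, ← Polynomial.natDegree_taylor f s]
  refine coeff_mulCharpoly_mem_pow_of_weights I _ (monic_taylor hf s) ?_ ?_ hgI k
  · rwa [Polynomial.natDegree_taylor]
  · rwa [Polynomial.natDegree_taylor]

end Weighted

/-! ## Thm. 4.11 (iii) for the coefficient algebra: `ḡ·W^n` is integral over `S[ψ_{g,j} W^{jn}]` -/

section Integral

variable {S : Type u} [CommRing S]

/-- All the homogenised coefficients `ψ_{g,k}·W^{(b−k)n}` (`0 ≤ k`) lie in the coefficient algebra (for `k = b`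
this is `1`, for `k > b` it is `0`). [cite: BravoVillamayor2010, Par. 2.8 (2.8.1)] -/
theorem monomial_coeff_mem_mulCharpolyRees' (f : S[X]) (hf : f.Monic) (g : S[X]) (n k : ℕ) :
    Polynomial.monomial ((f.natDegree - k) * n) ((mulCharpoly f hf g).coeff k) ∈ mulCharpolyRees f hf g n := by
  rcases subsingleton_or_nontrivial S with hS | hS
  · rw [Subsingleton.elim (Polynomial.monomial _ _) 0]
    exact zero_mem _
  rcases lt_or_ge k f.natDegree with hk | hk
  · have h := monomial_coeff_mem_mulCharpolyRees f hf g n (j := f.natDegree - k) (by omega) (Nat.sub_le _ _)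
    rwa [Nat.sub_sub_self hk.le] at h
  rcases hk.eq_or_lt with hk | hk
  · have h1 : (mulCharpoly f hf g).coeff k = 1 := by
      rw [← hk, ← natDegree_mulCharpoly f hf g]
      exact (mulCharpoly_monic f hf g).coeff_natDegree
    rw [← hk, Nat.sub_self, zero_mul, hk, h1, Polynomial.monomial_zero_one]
    exact one_mem _
  · rw [Polynomial.coeff_eq_zero_of_natDegree_lt (by rwa [natDegree_mulCharpoly]), map_zero]
    exact zero_mem _

/-- **`ḡ·W^n ∈ B[W]` is integral over the weighted coefficient algebra `S[ψ_{g,j}W^{jn}] ⊂ S[W]`**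
[Villamayor 2007, Thm. 4.11 (iii) p0022 L100–L102 «`𝒢̄` is integral over `R_𝒢`»; Bravo–Villamayor 2010 Par. 2.8
(2.8.1) «each endomorphism `L_{f_{n_i}}` has a characteristic polynomial … `T^n + g_{1,n_i}T^{n−1} + … + g_{n,n_i}`
where `g_{j,n_i} ∈ 𝒪[W]`»]: the homogenised Cayley–Hamilton identity
`(ḡW^n)^b + Σ_{k<b} (ψ_{g,k}W^{(b−k)n})·(ḡW^n)^k = W^{bn}·ψ_g(ḡ) = 0` exhibits `ḡ·W^n` (`B = S[Z]/⟨f⟩`) as a root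
of a MONIC polynomial with coefficients in `mulCharpolyRees f g n`, mapped into `B[W]`. (The printed (iii) is the
statement for `R_𝒢 ⊇ ℋ`; typed here is the integral dependence of each generator `ḡW^n` of `𝒢̄` on the algebra of
ITS OWN characteristic coefficients.) [cite: Villamayor2007, Thm. 4.11 (iii) p0022 L100–L102] -/
theorem isIntegralElem_monomial_mk (f : S[X]) (hf : f.Monic) (g : S[X]) (n : ℕ) :
    ((Polynomial.mapRingHom (AdjoinRoot.of f)).comp
        ((mulCharpolyRees f hf g n).val : mulCharpolyRees f hf g n →+* S[X])).IsIntegralElem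
      (Polynomial.monomial n (AdjoinRoot.mk f g)) := by
  classical
  let c : ℕ → mulCharpolyRees f hf g n := fun k =>
    ⟨Polynomial.monomial ((f.natDegree - k) * n) ((mulCharpoly f hf g).coeff k),
      monomial_coeff_mem_mulCharpolyRees' f hf g n k⟩
  have hc : ∀ k, ((mulCharpolyRees f hf g n).val : mulCharpolyRees f hf g n →+* S[X]) (c k) =
      Polynomial.monomial ((f.natDegree - k) * n) ((mulCharpoly f hf g).coeff k) := fun k => rfl
  refine ⟨Polynomial.X ^ f.natDegree + ∑ k ∈ Finset.range f.natDegree, Polynomial.C (c k) * Polynomial.X ^ k,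
    Polynomial.monic_X_pow_add ((Polynomial.degree_sum_le _ _).trans_lt ?_), ?_⟩
  · refine (Finset.sup_lt_iff ?_).mpr fun k hk => ?_
    · exact WithBot.bot_lt_coe _
    · exact (Polynomial.degree_C_mul_X_pow_le _ _).trans_lt (WithBot.coe_lt_coe.mpr (Finset.mem_range.mp hk))
  rcases subsingleton_or_nontrivial S with hS | hS
  · haveI : Subsingleton (AdjoinRoot f) := AdjoinRoot.mk_surjective.subsingleton
    exact Subsingleton.elim _ _
  -- Cayley–Hamilton, expanded along `ψ = T^b + Σ_{k<b} ψ_k T^k`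
  have h0 := aeval_mk_mulCharpoly f hf g
  rw [(mulCharpoly_monic f hf g).as_sum, natDegree_mulCharpoly, map_add, map_pow, Polynomial.aeval_X,
    map_sum] at h0
  simp only [map_mul, Polynomial.aeval_C, map_pow, Polynomial.aeval_X, AdjoinRoot.algebraMap_eq] at h0
  -- evaluate the monic polynomial at `ḡ W^n`
  rw [Polynomial.eval₂_add, Polynomial.eval₂_X_pow, Polynomial.eval₂_finsetSum]
  simp only [Polynomial.eval₂_mul, Polynomial.eval₂_C, Polynomial.eval₂_X_pow, RingHom.comp_apply, hc,
    Polynomial.coe_mapRingHom, Polynomial.map_monomial, Polynomial.monomial_pow,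
    Polynomial.monomial_mul_monomial]
  rw [Finset.sum_congr rfl fun k hk => by
    rw [show (f.natDegree - k) * n + n * k = n * f.natDegree by
      rw [mul_comm n k, ← add_mul, Nat.sub_add_cancel (Finset.mem_range.mp hk).le, mul_comm]]]
  rw [← map_sum, ← map_add, h0, map_zero]

end Integral

/-! ## Closed form for `deg f = 2` (the `Z`-quadratic specimens, e.g. `Z² + Y⁵`) -/

section Quadratic

variable {S : Type u} [CommRing S]

/-- `Z² + a₁Z + a₂` is monic. [cite: Villamayor2007, 1.18 p0010 L1–L7] -/
theorem monic_quadratic (a₁ a₂ : S) :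
    (Polynomial.X ^ 2 + Polynomial.C a₁ * Polynomial.X + Polynomial.C a₂).Monic := by
  nontriviality S
  rw [add_assoc]
  exact Polynomial.monic_X_pow_add ((Polynomial.degree_add_le _ _).trans_lt (max_lt
    ((Polynomial.degree_C_mul_X_le _).trans_lt (by exact_mod_cast Nat.lt_succ_self 1))
    ((Polynomial.degree_C_le).trans_lt (by exact_mod_cast Nat.zero_lt_two))))

/-- **Closed form of `ψ_g` for `f = Z² + a₁Z + a₂`, `g = c₀ + c₁Z`**:
`ψ_g(T) = T² − (2c₀ − a₁c₁)T + (c₀² − a₁c₀c₁ + a₂c₁²)` over any commutative ring (trace and determinant of the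
matrix `[[c₀, −a₂c₁], [c₁, c₀ − a₁c₁]]` of multiplication by `g` in the basis `1, Z`). For `c₁ = 0` this is
`(T − c₀)²` (`mulCharpoly_C`); Example 6.10 is `a₁ = 0, a₂ = Y⁵, c₀ = Y⁴, c₁ = 0` in characteristic two.
[cite: Villamayor2007, 1.18 p0010 L1–L7; Example 6.10 p0031 L31–L48] -/
theorem mulCharpoly_quadratic (a₁ a₂ c₀ c₁ : S)
    (hf : (Polynomial.X ^ 2 + Polynomial.C a₁ * Polynomial.X + Polynomial.C a₂).Monic) :
    mulCharpoly (Polynomial.X ^ 2 + Polynomial.C a₁ * Polynomial.X + Polynomial.C a₂) hf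
        (Polynomial.C c₀ + Polynomial.C c₁ * Polynomial.X) =
      Polynomial.X ^ 2 - Polynomial.C (2 * c₀ - a₁ * c₁) * Polynomial.X +
        Polynomial.C (c₀ ^ 2 - a₁ * c₀ * c₁ + a₂ * c₁ ^ 2) := by
  classical
  nontriviality S
  haveI := hf.free_adjoinRoot
  haveI := hf.finite_adjoinRoot
  set f := Polynomial.X ^ 2 + Polynomial.C a₁ * Polynomial.X + Polynomial.C a₂ with hf_def
  set g := Polynomial.C c₀ + Polynomial.C c₁ * Polynomial.X with hg_def
  have hfdeg' : f.degree = 2 := by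
    rw [hf_def, add_assoc, Polynomial.degree_add_eq_left_of_degree_lt, Polynomial.degree_X_pow]
    · rfl
    · rw [Polynomial.degree_X_pow]
      exact (Polynomial.degree_add_le _ _).trans_lt (max_lt
        ((Polynomial.degree_C_mul_X_le _).trans_lt (by exact_mod_cast one_lt_two))
        (Polynomial.degree_C_le.trans_lt (by exact_mod_cast two_pos)))
  have hfdeg : f.natDegree = 2 := Polynomial.natDegree_eq_of_degree_eq_some hfdeg'
  have hgdeg : g.degree < 2 :=
    (Polynomial.degree_add_le _ _).trans_lt (max_lt (Polynomial.degree_C_le.trans_lt (by decide))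
      ((Polynomial.degree_C_mul_X_le _).trans_lt (by exact_mod_cast one_lt_two)))
  -- the two columns of the matrix: `g mod f = g`, `gZ mod f = −a₂c₁ + (c₀ − a₁c₁)Z`
  have hcol0 : g %ₘ f = g := by
    rw [Polynomial.modByMonic_eq_self_iff hf, hfdeg']
    exact hgdeg
  have hcol1 : (g * Polynomial.X) %ₘ f = Polynomial.C (-(a₂ * c₁)) + Polynomial.C (c₀ - a₁ * c₁) * Polynomial.X := by
    refine (Polynomial.div_modByMonic_unique (Polynomial.C c₁) _ hf ⟨?_, ?_⟩).2
    · rw [hf_def, hg_def, map_neg, map_sub, map_mul, map_mul]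
      ring
    · rw [hfdeg']
      exact (Polynomial.degree_add_le _ _).trans_lt (max_lt (Polynomial.degree_C_le.trans_lt (by decide))
        ((Polynomial.degree_C_mul_X_le _).trans_lt (by exact_mod_cast one_lt_two)))
  -- the matrix, reindexed to `Fin 2`
  set e : Fin (AdjoinRoot.powerBasis' hf).dim ≃ Fin 2 := finCongr hfdeg with he
  set M := LinearMap.toMatrix (AdjoinRoot.powerBasis' hf).basis (AdjoinRoot.powerBasis' hf).basis
    (Algebra.lmul S (AdjoinRoot f) (AdjoinRoot.mk f g)) with hM
  have hM' : Matrix.reindex e e M = !![c₀, -(a₂ * c₁); c₁, c₀ - a₁ * c₁] := by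
    ext i j
    rw [Matrix.reindex_apply, Matrix.submatrix_apply, hM, toMatrix_lmul_mk_apply, he, finCongr_symm,
      finCongr_apply_coe, finCongr_apply_coe]
    have hg0 : g.coeff 0 = c₀ := by simp [hg_def]
    have hg1 : g.coeff 1 = c₁ := by simp [hg_def]
    fin_cases i <;> fin_cases j <;> simp [hcol0, hcol1, hg0, hg1]
  have h1 : c₀ + (c₀ - a₁ * c₁) = 2 * c₀ - a₁ * c₁ := by ring
  have h2 : c₀ * (c₀ - a₁ * c₁) - -(a₂ * c₁) * c₁ = c₀ ^ 2 - a₁ * c₀ * c₁ + a₂ * c₁ ^ 2 := by ring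
  rw [mulCharpoly, ← LinearMap.charpoly_toMatrix _ (AdjoinRoot.powerBasis' hf).basis, ← hM,
    ← Matrix.charpoly_reindex e, hM', Matrix.charpoly_fin_two, Matrix.trace_fin_two_of, Matrix.det_fin_two_of,
    h1, h2]

end Quadratic

/-! ## Purely inseparable specimens `Z^p + a` in characteristic `p` (Example 6.10 generalised) -/

section CharP

variable {S : Type u} [CommRing S]

/-- In characteristic `p`, for `f` monic of degree `p` and a constant `c`: `ψ_c = (T − c)^p = T^p − c^p`
(Example 6.10 is `p = 2`, `f = Z² + Y⁵`, `c = Y⁴`). [cite: Villamayor2007, Example 6.10 p0031 L31–L48] -/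
theorem mulCharpoly_C_of_charP (p : ℕ) [Fact p.Prime] [CharP S p] (f : S[X]) (hf : f.Monic)
    (hdeg : f.natDegree = p) (c : S) :
    mulCharpoly f hf (Polynomial.C c) = Polynomial.X ^ p - Polynomial.C (c ^ p) := by
  haveI : Nontrivial S := CharP.nontrivial_of_char_ne_one (R := S) (Fact.out : p.Prime).ne_one
  rw [mulCharpoly_C, hdeg, sub_pow_char, ← map_pow]

/-- In characteristic `p`, for `f` monic of degree `p` (e.g. the purely inseparable `Z^p + a`) and a weight-`n`
constant generator `c·W^n`: the weighted coefficient algebra of `ψ_c = T^p − c^p` is `S[c^p·W^{pn}]` — the only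
non-zero coefficient below the leading one is the constant term (Example 6.10: «`ℋ_𝒢` is generated by `Y⁸W²`»,
`p = 2`, `c = Y⁴`, `n = 1`). [cite: Villamayor2007, Example 6.10 p0031 L31–L48] -/
theorem mulCharpolyRees_C_of_charP (p : ℕ) [Fact p.Prime] [CharP S p] (f : S[X]) (hf : f.Monic)
    (hdeg : f.natDegree = p) (c : S) (n : ℕ) :
    mulCharpolyRees f hf (Polynomial.C c) n = Algebra.adjoin S {Polynomial.monomial (p * n) (c ^ p)} := by
  haveI : Nontrivial S := CharP.nontrivial_of_char_ne_one (R := S) (Fact.out : p.Prime).ne_one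
  have hp : 0 < p := (Fact.out : p.Prime).pos
  have hψ := mulCharpoly_C_of_charP p f hf hdeg c
  have hcoeff : ∀ j, 1 ≤ j → j ≤ p → (Polynomial.X ^ p - Polynomial.C (c ^ p) : S[X]).coeff (p - j) =
      if j = p then -c ^ p else 0 := by
    intro j hj1 hjp
    rw [Polynomial.coeff_sub, Polynomial.coeff_X_pow, Polynomial.coeff_C, if_neg (by omega)]
    split_ifs with h1 h2 h2
    · rw [zero_sub]
    · exact absurd h1 (by omega)
    · exact absurd h2 (by omega)
    · rw [sub_zero]
  apply le_antisymm
  · refine Algebra.adjoin_le ?_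
    rintro q ⟨j, hj1, hj2, rfl⟩
    rw [hdeg] at hj2
    rw [hdeg, hψ, hcoeff j hj1 hj2, SetLike.mem_coe]
    split_ifs with h
    · rw [h, map_neg]
      exact neg_mem (Algebra.subset_adjoin (Set.mem_singleton _))
    · rw [map_zero]
      exact zero_mem _
  · refine Algebra.adjoin_le (Set.singleton_subset_iff.mpr ?_)
    rw [SetLike.mem_coe]
    have h := monomial_coeff_mem_mulCharpolyRees f hf (Polynomial.C c) n (j := p) hp hdeg.symm.le
    rw [hdeg, hψ, hcoeff p hp le_rfl, if_pos rfl, map_neg] at h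
    exact (neg_mem_iff (x := Polynomial.monomial (p * n) (c ^ p))).mp h

end CharP

end Literature.AlgebraicGeometry.Villamayor2007

end
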